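import Literature.Barriers.CriticalPhenomena.NienhuisWeightsExcludeVertexSAW
import HarnessLib

/-!
# Barrier (SAWScalingLimit): no exact vertex relation for the STIFFNESS-deformed square-lattice SAW observable

Companion to `Literature.Barriers.CriticalPhenomena.NienhuisWeightsExcludeVertexSAW` (same
catalogue entry, sub-problem `SAWScalingLimit`). That file proves that the uniform square-lattice
SAW's mid-edge parafermionic observable satisfies NO exact single-vertex linear relation with
vertex-independent coefficients (`not_hasExactVertexRelationZ2`, Appendix A; technique class
`ExactVertexRelationZ2 x σ c`). Its `scope_caveats (b)` lists what is NOT excluded there, among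
them "observables of modified walks". This file settles the first such modification, the one the
printed classification singles out: the **two-fugacity (stiffness / semi-flexible) deformation**
in which a vertex crossed STRAIGHT carries weight `v` and a vertex where the walk TURNS carries
weight `u` — in the plaquette language of Ikhlef–Cardy / Glazman the weights
`(t, u₁, u₂, v, w₁, w₂) = (1, u, u, v, 0, 0)`, i.e. the `w₁ = w₂ = 0` slice of the `O(0)` plaquette
model through the uniform walk `(1, x, x, x, 0, 0)` (Duminil-Copin 2013, Remark 12.13).

## What the sources print

* Glazman 2015 (ECP 20, no. 86), Lemma 3.1 (as quoted in the `because:` block of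
  `NienhuisWeightsExcludeVertexSAW`): for `σ = ℓ/8`, `ℓ` odd, the plaquette weights for which the
  parafermionic observable satisfies the half-Cauchy–Riemann relation around a rhombus are UNIQUE
  (Nienhuis' weights (1.1)–(1.5), which have `w₁ = w₂ > 0` at `θ = π/2`); for `σ = 1` they form
  the degenerate family `u₁ + u₂ = 1, w₁ = u₁, w₂ = u₂`; "for all other values of `σ` the weights …
  exist only for some specific values of `θ`" — in particular no discretely holomorphic weight
  system has `w₁ = w₂ = 0` with `u₁ u₂ v ≠ 0`. [cite: Glazman2015WeightedSAW, Lemma 3.1]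
* Ikhlef–Cardy 2009, §3: the holomorphicity "linear system for the Boltzmann weights" and its
  solutions (the integrable weights). [cite: IkhlefCardy2009, §3]
* Duminil-Copin–Smirnov 2012, Lemma 1: the SHAPE of the relation,
  `(p - v)F(p) + (q - v)F(q) + (r - v)F(r) = 0`. [cite: DuminilCopinSmirnov2012, Lemma 1]
* Beaton–Guttmann–Jensen 2012, p. 2: on `ℤ²` "there is no known appropriate parafermionic
  observable satisfying an identity like (1)". [cite: BeatonGuttmannJensen2012, p. 2]

## What is formalised (namespace `Literature.Barriers.CriticalPhenomena`)

* `turnCount`, `straightCount` (combinatorial turn / straight-passage counts of a lattice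
  polyline), `stiffnessHalfEdgeTerm`, **`stiffnessMidEdgeObservable Ω δ a u v σ e`**: the mid-edge
  parafermionic observable of `SAWParafermion.lean` with the weight `x^{#vertices}` replaced by
  `u^{#turning vertices} v^{#straight vertices}` (the root, an endpoint of the polyline, carries no
  weight; the last lattice vertex is weighted according to the half-edge it continues into);
  `stiffnessMidEdgeObservable_diag`: at `u = v = x` it is the library's observable divided by the
  root factor `x` (PROVED), so the deformation is literally a deformation.
* The technique class **`ExactVertexRelationZ2Stiffness u v σ c`** (same quantifiers as
  `ExactVertexRelationZ2`: every plane domain, mesh, boundary root, and vertex with its four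
  neighbours in the domain) and `exactVertexRelationZ2Stiffness_diag_iff` (at `u = v = x ≠ 0` it
  IS `ExactVertexRelationZ2 x σ c`).
* **`NoExactVertexRelationZ2Stiffness`** (named statement) and its discharge
  `NoExactVertexRelationZ2Stiffness_holds`: for all `u v : ℂ` with `u ≠ 0`, `v ≠ 0`, `u² ≠ v²`,
  every real spin `σ` and every `c`, the relation forces `c = 0`. Together with Appendix A
  (`exactVertexRelationZ2_eq_zero`, the diagonal `u = v = x ∈ (0,1)`) this empties the class on
  `{u v ≠ 0, u² ≠ v²} ∪ {u = v ∈ (0,1)}`; the physical slice is `exactVertexRelationZ2Stiffness_eq_zero_real`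
  (`0 < u`, `0 < v`, `u ≠ v`).

## Proof (six instances, then a four-line elimination)

The relation is instantiated at mesh `1`, vertex `v = (0,0)`, on Appendix A's plus `P` (each of
the four arms as root) and on Appendix A's domain `T = P ∪` the 8-cycle
`v, N, (0,2), (-1,2), (-2,2), (-2,1), (-2,0), W`, rooted once at the east arm `(1,0)` and once at the
south arm `(0,-1)` (both leaves; the walk enumerations of `NienhuisWeightsExcludeVertexSAW` are
re-used for `P` and `T`/east, and redone by the same `dfs` certificate for `T`/south). With
`t = e^{-iσπ/2}` the rows (slot order `E, N, W, S`) are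
`P`: `(1, u t⁻¹, v, u t)` and its cyclic shifts (group one: a prefix and its three one-step
continuations through `v`); `T`/east: `P`/east `+ u³v⁴ (0, v t⁻³, u t², 0)`; `T`/south:
`P`/south `+ u³v⁴ (0, u t⁻², v t³, 0)` — the loop-return pair through the ADJACENT exits `N, W`
seen from the two prefix sides. The mechanism: reversing the excursion `N ⇝ W` preserves the
turn/straight status of every vertex of the loop EXCEPT `v` itself, where one member of the pair
goes straight (`v`) and the other turns (`u`); from the east prefix the straight member is the one
exiting through `W`, from the south prefix it is the one exiting through `N`. Hence
`c_N v t⁻³ + c_W u t² = 0` and `c_N u t⁻² + c_W v t³ = 0`, a `2 × 2` system of determinant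
`v² - u²`: for `u² ≠ v²`, `c_N = c_W = 0`, and group one then gives `c_E = c_S = 0` (it leaves
`c_S ≠ 0` only if `u² = 1 = v²`). For the uniform walk (`u = v`) the two pair conditions coincide
— this is exactly the slack that Appendix A has to remove with an OPPOSITE-return instance and
the inequality `0 < x < 1`; off the diagonal no inequality and no opposite return is needed.

Written for the venture lane «pcv-sawmu» (Tier B, ℤ² search protocol `Z2-SEARCH-PROTOCOL.md` §6
P-T / product T1: the class `S-Z2-T` of the certified blind search, found EMPTY-CERT on the pilot
range; this file is the range-free theorem for the single-vertex stencil).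
-/

noncomputable section

open Real
open Literature.Probability.Percolation Literature.Probability.LatticeModels

namespace Literature.Barriers.CriticalPhenomena

/-! ### Turn and straight-passage counts of a lattice polyline -/

/-- Number of internal vertices of a lattice polyline `ω₀, ω₁, …, ωₙ` at which it goes STRAIGHT on
(`ω_{i+1} - ω_i = ω_i - ω_{i-1}`). [folklore] -/
def straightCount : List (Site 2) → ℕ
  | p :: q :: r :: l => (if r - q = q - p then 1 else 0) + straightCount (q :: r :: l)
  | _ => 0

/-- Number of internal vertices of a lattice polyline at which it does NOT go straight on (on a
nearest-neighbour path of `ℤ²` continued without backtracking: a quarter TURN). [folklore] -/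
def turnCount : List (Site 2) → ℕ
  | p :: q :: r :: l => (if r - q = q - p then 0 else 1) + turnCount (q :: r :: l)
  | _ => 0

/-- Every internal vertex either turns or goes straight: `turnCount + straightCount = length - 2`.
[folklore] -/
private theorem turnCount_add_straightCount : ∀ l : List (Site 2), turnCount l + straightCount l = l.length - 2
  | [] => by simp [turnCount, straightCount]
  | [_] => by simp [turnCount, straightCount]
  | [_, _] => by simp [turnCount, straightCount]
  | p :: q :: r :: l => by
    have ih := turnCount_add_straightCount (q :: r :: l)
    simp only [turnCount, straightCount, List.length_cons] at ih ⊢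
    split_ifs <;> omega

/-! ### The stiffness-deformed mid-edge observable -/

open Literature.Probability.RandomPlanarGeometry.SAW in
/-- The contribution to the STIFFNESS-deformed mid-edge observable of the walks reaching the edge
`{z, w}` from the `z` side: SAWs `γ : a → z` of `Ω_δ` not having used `{z, w}`, continued by the
half-edge towards `w`; weight `e^{-iσW} u^{T} v^{S}` with `W` the winding of the continued polyline
and `T` / `S` the number of lattice vertices of `γ` (the root `a` excluded, the endpoint `z`
included, judged by the continuation towards `w`) at which the polyline turns / goes straight.
This is `halfEdgeTerm` of `SAWParafermion.lean` with `x^{|γ|+1}` replaced by `u^T v^S`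
(`T + S = |γ|`). [cite: DuminilCopinSmirnov2012, Def. 1 (shape of the observable)]
[cite: Glazman2015WeightedSAW, (1.1)-(1.5) (plaquette weights; here `(1,u,u,v,0,0)`)] -/
def stiffnessHalfEdgeTerm (Ω : Set ℂ) (δ : ℝ) (a : Site 2) (u v : ℂ) (σ : ℝ) (z w : Site 2) : ℂ :=
  ∑' γ : DomainSAW Ω δ a z,
    if s(z, w) ∈ γ.walk.edges then 0 else
      Complex.exp (-Complex.I * σ *
          (Literature.Probability.LatticeModels.winding (γ.walk.support.map (meshPoint δ) ++ [medialPoint δ s(z, w)]) : ℝ)) *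
        (u ^ turnCount (γ.walk.support ++ [w]) * v ^ straightCount (γ.walk.support ++ [w]))

/-- **The stiffness-deformed SAW parafermionic observable on `δℤ²` (mid-edge version)** at the edge
`e = {z, w}`: the sum of the two half-edge terms; fugacity `u` per turning vertex, `v` per vertex
crossed straight, spin `σ`. In plaquette language the weights `(t,u₁,u₂,v,w₁,w₂) = (1,u,u,v,0,0)`.
[cite: DuminilCopinSmirnov2012, Def. 1 (shape of the observable)]
[cite: DuminilCopin2013Parafermion, Remark 12.13 (the uniform walk is `(1,x,x,x,0,0)`)] -/
def stiffnessMidEdgeObservable (Ω : Set ℂ) (δ : ℝ) (a : Site 2) (u v : ℂ) (σ : ℝ) :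
    Sym2 (Site 2) → ℂ :=
  Sym2.lift ⟨fun z w => stiffnessHalfEdgeTerm Ω δ a u v σ z w + stiffnessHalfEdgeTerm Ω δ a u v σ w z,
    fun _ _ => add_comm _ _⟩

/-- `stiffnessMidEdgeObservable` on an explicit edge (definitional unfolding).
[cite: DuminilCopinSmirnov2012, Def. 1 (shape of the observable)] -/
@[simp] theorem stiffnessMidEdgeObservable_mk (Ω : Set ℂ) (δ : ℝ) (a : Site 2) (u v : ℂ) (σ : ℝ)
    (z w : Site 2) :
    stiffnessMidEdgeObservable Ω δ a u v σ s(z, w) =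
      stiffnessHalfEdgeTerm Ω δ a u v σ z w + stiffnessHalfEdgeTerm Ω δ a u v σ w z := rfl

open Literature.Probability.RandomPlanarGeometry.SAW in
/-- **Diagonal = the library's observable.** At `u = v = x` the stiffness half-edge term times the
root factor `x` is `halfEdgeTerm` (`u^T v^S · x = x^{|γ|+1}`): the uniform vertex SAW is the plaquette model
at `(1, x, x, x, 0, 0)`. [cite: DuminilCopin2013Parafermion, Remark 12.13] -/
theorem stiffnessHalfEdgeTerm_diag (Ω : Set ℂ) (δ : ℝ) (a : Site 2) (x σ : ℝ) (z w : Site 2) :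
    stiffnessHalfEdgeTerm Ω δ a x x σ z w * x = halfEdgeTerm Ω δ a x σ z w := by
  unfold stiffnessHalfEdgeTerm halfEdgeTerm
  rw [← tsum_mul_right]
  refine tsum_congr fun γ => ?_
  split_ifs with h
  · exact zero_mul _
  · have hTS := turnCount_add_straightCount (γ.walk.support ++ [w])
    have hlen : (γ.walk.support ++ [w]).length - 2 = γ.length := by
      simp [SimpleGraph.Walk.length_support, DomainSAW.length]
    rw [hlen] at hTS
    rw [mul_assoc, ← pow_add, hTS, ← pow_succ]

open Literature.Probability.RandomPlanarGeometry.SAW in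
/-- **Diagonal = the library's observable** (mid-edge version): at `u = v = x`,
`stiffnessMidEdgeObservable · x = midEdgeParafermionicObservable` (the uniform walk is the point
`(1, x, x, x, 0, 0)` of the plaquette weights). [cite: DuminilCopin2013Parafermion, Remark 12.13] -/
theorem stiffnessMidEdgeObservable_diag (Ω : Set ℂ) (δ : ℝ) (a : Site 2) (x σ : ℝ) (e : Sym2 (Site 2)) :
    stiffnessMidEdgeObservable Ω δ a x x σ e * x = midEdgeParafermionicObservable Ω δ a x σ e := by
  induction e using Sym2.ind with
  | h z w =>
    rw [stiffnessMidEdgeObservable_mk, midEdgeParafermionicObservable_mk, add_mul,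
      stiffnessHalfEdgeTerm_diag, stiffnessHalfEdgeTerm_diag]

/-! ### The technique class and the barrier statement -/

/-- **Technique class (explicit).** `ExactVertexRelationZ2Stiffness u v σ c`: the coefficients
`c : Fin 4 → ℂ` give an EXACT LOCAL LINEAR RELATION for the stiffness-deformed square-lattice
observable `F = stiffnessMidEdgeObservable Ω δ a u v σ` — for every discrete domain `Ω_δ ⊆ δℤ²`,
every root `a ∈ Ω_δ` on its boundary and every vertex `v₀` whose four neighbours are joined to it
in `Ω_δ`, `Σᵢ cᵢ F({v₀, v₀ + dirᵢ}) = 0` (the quantifiers of `ExactVertexRelationZ2` verbatim;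
Duminil-Copin–Smirnov's Lemma 1 shape). [cite: DuminilCopinSmirnov2012, Lemma 1 (shape of the relation)] -/
def ExactVertexRelationZ2Stiffness (u v : ℂ) (σ : ℝ) (c : Fin 4 → ℂ) : Prop :=
  ∀ (Ω : Set ℂ) (δ : ℝ) (a v₀ : Site 2), 0 < δ → a ∈ meshDomain Ω δ →
    (∃ w : Site 2, (zdGraph 2).Adj a w ∧ meshPoint δ w ∉ Ω) →
    (∀ i : Fin 4, (discreteDomainGraph Ω δ).Adj v₀ (v₀ + dirZ2 i)) →
      ∑ i : Fin 4, c i * stiffnessMidEdgeObservable Ω δ a u v σ s(v₀, v₀ + dirZ2 i) = 0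

/-- The technique class is non-vacuously typed: `c = 0` always works. [folklore] -/
private theorem exactVertexRelationZ2Stiffness_zero (u v : ℂ) (σ : ℝ) : ExactVertexRelationZ2Stiffness u v σ 0 := by
  intro Ω δ a v₀ _ _ _ _
  simp

open Literature.Probability.RandomPlanarGeometry.SAW in
/-- **On the diagonal the class IS Appendix A's class**: for `x ≠ 0`,
`ExactVertexRelationZ2Stiffness x x σ c ↔ ExactVertexRelationZ2 x σ c` (the uniform walk is the
plaquette point `(1, x, x, x, 0, 0)`). [cite: DuminilCopin2013Parafermion, Remark 12.13] -/
theorem exactVertexRelationZ2Stiffness_diag_iff {x : ℝ} (hx : x ≠ 0) (σ : ℝ) (c : Fin 4 → ℂ) :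
    ExactVertexRelationZ2Stiffness x x σ c ↔ ExactVertexRelationZ2 x σ c := by
  have key : ∀ (Ω : Set ℂ) (δ : ℝ) (a v₀ : Site 2),
      ∑ i : Fin 4, c i * midEdgeParafermionicObservable Ω δ a x σ s(v₀, v₀ + dirZ2 i) =
        (∑ i : Fin 4, c i * stiffnessMidEdgeObservable Ω δ a x x σ s(v₀, v₀ + dirZ2 i)) * x := by
    intro Ω δ a v₀
    rw [Finset.sum_mul]
    refine Finset.sum_congr rfl fun i _ => ?_
    rw [← stiffnessMidEdgeObservable_diag, mul_assoc]
  have hx' : (x : ℂ) ≠ 0 := Complex.ofReal_ne_zero.2 hx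
  constructor
  · intro h Ω δ a v₀ hδ ha hb hv
    rw [key, h Ω δ a v₀ hδ ha hb hv, zero_mul]
  · intro h Ω δ a v₀ hδ ha hb hv
    have h' := h Ω δ a v₀ hδ ha hb hv
    rw [key] at h'
    exact (mul_eq_zero.1 h').resolve_right hx'

/-- **Barrier `NoExactVertexRelationZ2Stiffness`.** The stiffness (two-fugacity) deformation of
the uniform square-lattice SAW — weight `u` per turning vertex, `v` per straight vertex, i.e. the
`w₁ = w₂ = 0`, `u₁ = u₂` slice of the `O(0)` plaquette model — admits NO exact single-vertex linear
relation of Duminil-Copin–Smirnov type with vertex-independent coefficients, at any complex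
`u, v` with `u v ≠ 0`, `u² ≠ v²` (diagonal and anti-diagonal excluded; `u = v ∈ (0,1)` is Appendix A) and any real spin: the technique class
`ExactVertexRelationZ2Stiffness u v σ c` forces `c = 0`. PROVED below
(`NoExactVertexRelationZ2Stiffness_holds`); the diagonal `u = v = x ∈ (0,1)` is Appendix A of the
companion file (`exactVertexRelationZ2_eq_zero`, via `exactVertexRelationZ2Stiffness_diag_iff`).

BARRIER (structured block, D-0021):
- technique_class: discrete-holomorphicity parafermionic-observable exact-local-relation stiffness-deformation two-fugacity semi-flexible-SAW — explicitly the predicate `ExactVertexRelationZ2Stiffness u v σ c` (an exact local linear relation `Σᵢ cᵢ F({v₀, v₀+dirᵢ}) = 0`, `c` vertex-independent, for `stiffnessMidEdgeObservable` at turn fugacity `u`, straight fugacity `v`, spin `σ`); at `u = v = x` it is `ExactVertexRelationZ2 x σ c` of `NienhuisWeightsExcludeVertexSAW` (`exactVertexRelationZ2Stiffness_diag_iff`)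
- blocks: repairing the failure of the Duminil-Copin–Smirnov vertex identity on `ℤ²` (`not_hasExactVertexRelationZ2`) by the nearest deformation of the uniform walk that keeps it a vertex-self-avoiding walk without self-touchings — an extra per-turn (equivalently per-straight-passage) fugacity, plaquette weights `(1,u,u,v,0,0)` — and hence any parafermionic route to the growth constant or scaling limit of semi-flexible square-lattice SAWs through an exact radius-1 identity [cite: Glazman2015WeightedSAW, Lemma 3.1] [cite: BeatonGuttmannJensen2012, p. 2]
- because: in the printed classification the discretely holomorphic `n = 0` plaquette weights at `θ = π/2` are unique for `σ ∈ (2ℤ+1)/8` and have `w₁ = w₂ > 0`, the `σ = 1` family has `w₁ = u₁, w₂ = u₂`, so no holomorphic weight system has `w₁ = w₂ = 0` with `u₁ u₂ v ≠ 0` [cite: Glazman2015WeightedSAW, Lemma 3.1] [cite: IkhlefCardy2009, §3]; for the formal technique class the obstruction is unconditional and elementary (this file): on the plus `P` the relation restricts `c` to the group-one conditions `c_k + u t⁻¹ c_{k+1} + v c_{k+2} + u t c_{k+3} = 0`; a loop returning to `v₀` through the ADJACENT exits `N, W` contributes the pair condition `c_N v t⁻³ + c_W u t² = 0` when the prefix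 arrives from the east and `c_N u t⁻² + c_W v t³ = 0` when it arrives from the south (reversal of the excursion preserves every turn/straight status except at `v₀`, where one member turns and the other goes straight), a `2×2` system of determinant `v² − u²`; so `u² ≠ v²` forces `c_N = c_W = 0` and then `c = 0` (domains `P` ×4 roots, `T` rooted east and south) [cite: DuminilCopinSmirnov2012, Lemma 1]
- evasions_known: the integrable neighbours with self-touching, `w₁ = w₂ > 0` (Glazman 2015 Thm 1.1; Glazman–Manolescu 2019, tree `YangBaxterSAWLocalRelations` `groupOne_*`/`groupTwo_*`) [cite: Glazman2015WeightedSAW, Theorem 1.1] [cite: GlazmanManolescu2019, Theorems 1–3]; inexact / asymptotic strip identities [cite: BeatonGuttmannJensen2012, pp. 2, 5]; identities with an explicit remainder over loop-return walks, multi-vertex stencils, boundary identities (none excluded here)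
- scope_caveats: (a) excluded are ONLY 4-term single-vertex stencils with root-, domain- and vertex-independent coefficients for the observable `stiffnessMidEdgeObservable` (walks from a boundary root; the six instances used are rooted at leaves, so vertex- versus mid-edge-rooting is immaterial), on the parameter set `{u ≠ 0, v ≠ 0, u² ≠ v²} ⊂ ℂ²` (all real spins `σ`) — diagonal `u = v` AND anti-diagonal `u = -v` excluded (both pair conditions of this file coincide there; re-derived independently by the lane's referee b-ref g6, 2026-08-22); the diagonal `u = v` is the uniform walk, settled for real `x ∈ (0,1)` in the companion file and NOT re-proved here (at `u = v` the two pair conditions of this file coincide and an opposite-return instance plus `0 < x < 1` are needed); the anti-diagonal `u = -v` and the axes `u = 0` / `v = 0` are not treated (`u = 0, v = ±1` carries the trivial straight-walk identities `c = (1, 0, ∓1, 0)`, so some hypothesis there is necessary); (b) two of the six instances live on the non-simply-connected domain `T` of Appendix A (plus ∪ an 8-cycle); a star-convex variant in the manner of `NienhuisWeightsExcludeVertexSAWStarConvex` (unit squares `Q` rooted at two different leaves) is expected to work verbatim and is not included; (c) NOT formalised: the plaquette `O(n)` model and its observable, so the printed classification stays quoted; multi-vertex stencils, remainder-resolved and boundary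 classes of the lane's search protocol are not addressed by this theorem
- status: established — `NoExactVertexRelationZ2Stiffness_holds` (this file, axioms standard); printed counterpart quoted [cite: Glazman2015WeightedSAW, Lemma 3.1]

[cite: Glazman2015WeightedSAW, Lemma 3.1] [cite: DuminilCopinSmirnov2012, Lemma 1 (shape of the relation)] -/
def NoExactVertexRelationZ2Stiffness : Prop :=
  ∀ (u v : ℂ) (σ : ℝ) (c : Fin 4 → ℂ), u ≠ 0 → v ≠ 0 → u ^ 2 ≠ v ^ 2 →
    ExactVertexRelationZ2Stiffness u v σ c → c = 0

/-! ## Proof: six explicit instances and an elimination -/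

section TechniqueClassEmpty

open Complex

namespace NoVertexRelationStiffness

open NoVertexRelation

/-! ### Evaluating stiffness half-edge terms -/

open Literature.Probability.RandomPlanarGeometry.SAW in
/-- A stiffness half-edge term with a single contributing walk `γ₀` (every other SAW to `z` has used
the edge `{z, w}`) equals the summand of `γ₀`. [folklore] -/
private theorem sHET_eq_single {Ω : Set ℂ} {δ : ℝ} {a z : Site 2} (u v : ℂ) (σ : ℝ) (w : Site 2)
    (γ₀ : DomainSAW Ω δ a z) (h : ∀ γ : DomainSAW Ω δ a z, γ ≠ γ₀ → s(z, w) ∈ γ.walk.edges) :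
    stiffnessHalfEdgeTerm Ω δ a u v σ z w =
      if s(z, w) ∈ γ₀.walk.edges then 0 else
        Complex.exp (-Complex.I * σ *
            (Literature.Probability.LatticeModels.winding (γ₀.walk.support.map (meshPoint δ) ++ [medialPoint δ s(z, w)]) : ℝ)) *
          (u ^ turnCount (γ₀.walk.support ++ [w]) * v ^ straightCount (γ₀.walk.support ++ [w])) := by
  unfold stiffnessHalfEdgeTerm
  exact tsum_eq_single γ₀ fun γ hγ => if_pos (h γ hγ)

open Literature.Probability.RandomPlanarGeometry.SAW in
/-- A stiffness half-edge term vanishes when every SAW to `z` has used the edge `{z, w}`. [folklore] -/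
private theorem sHET_eq_zero {Ω : Set ℂ} {δ : ℝ} {a z : Site 2} (u v : ℂ) (σ : ℝ) (w : Site 2)
    (h : ∀ γ : DomainSAW Ω δ a z, s(z, w) ∈ γ.walk.edges) : stiffnessHalfEdgeTerm Ω δ a u v σ z w = 0 := by
  unfold stiffnessHalfEdgeTerm
  rw [tsum_congr (g := fun _ => (0 : ℂ)) fun γ => if_pos (h γ), tsum_zero]

/-! #### Instance `P`, root `(1, 0)` — stiffness observable -/

/-- Value of one half-edge term of the stiffness observable on the explicit domain (enumeration certificate + integer turn/winding counts). [folklore] -/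
private theorem sHET_P_1_0_E_out (u v : ℂ) (σ : ℝ) :
    stiffnessHalfEdgeTerm (Omega PE) 1 (toSite (1, 0)) u v σ (toSite (0, 0)) (toSite (1, 0)) =
      0 := by
  refine sHET_eq_zero u v σ (toSite (1, 0)) fun γ => ?_
  rw [enum_P_1_0_0 γ]; decide

/-- Value of one half-edge term of the stiffness observable on the explicit domain (enumeration certificate + integer turn/winding counts). [folklore] -/
private theorem sHET_P_1_0_E_in (u v : ℂ) (σ : ℝ) :
    stiffnessHalfEdgeTerm (Omega PE) 1 (toSite (1, 0)) u v σ (toSite (1, 0)) (toSite (0, 0)) =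
      1 := by
  rw [sHET_eq_single u v σ (toSite (0, 0)) nil_P_1_0 (fun γ hγ => absurd (enum_P_1_0_1 γ) hγ)]
  rw [if_neg (by decide), winding_support_medial nil_P_1_0.walk (toSite (0, 0)) (by decide),
    show quarterTurns (List.map ofSite nil_P_1_0.walk.support ++ [ofSite (toSite (0, 0))]) = 0 from by decide,
    show turnCount (nil_P_1_0.walk.support ++ [toSite (0, 0)]) = 0 from by decide,
    show straightCount (nil_P_1_0.walk.support ++ [toSite (0, 0)]) = 0 from by decide, cexp_quarter_0 σ]
  ring

/-- Value of the stiffness mid-edge observable at one of the four edges at the origin, on the explicit domain. [folklore] -/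
private theorem sF_P_1_0_E (u v : ℂ) (σ : ℝ) :
    stiffnessMidEdgeObservable (Omega PE) 1 (toSite (1, 0)) u v σ s(toSite (0, 0), toSite (1, 0)) =
      1 := by
  simp only [stiffnessMidEdgeObservable_mk, sHET_P_1_0_E_out, sHET_P_1_0_E_in, zero_add]

/-- Value of one half-edge term of the stiffness observable on the explicit domain (enumeration certificate + integer turn/winding counts). [folklore] -/
private theorem sHET_P_1_0_N_out (u v : ℂ) (σ : ℝ) :
    stiffnessHalfEdgeTerm (Omega PE) 1 (toSite (1, 0)) u v σ (toSite (0, 0)) (toSite (0, 1)) =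
      u * (tOf σ)⁻¹ := by
  rw [sHET_eq_single u v σ (toSite (0, 1)) w_P_1_0_0_0 (fun γ hγ => absurd (enum_P_1_0_0 γ) hγ)]
  rw [if_neg (by decide), winding_support_medial w_P_1_0_0_0.walk (toSite (0, 1)) (by decide),
    show quarterTurns (List.map ofSite w_P_1_0_0_0.walk.support ++ [ofSite (toSite (0, 1))]) = -1 from by decide,
    show turnCount (w_P_1_0_0_0.walk.support ++ [toSite (0, 1)]) = 1 from by decide,
    show straightCount (w_P_1_0_0_0.walk.support ++ [toSite (0, 1)]) = 0 from by decide, cexp_quarter_m1 σ]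
  ring

/-- Value of one half-edge term of the stiffness observable on the explicit domain (enumeration certificate + integer turn/winding counts). [folklore] -/
private theorem sHET_P_1_0_N_in (u v : ℂ) (σ : ℝ) :
    stiffnessHalfEdgeTerm (Omega PE) 1 (toSite (1, 0)) u v σ (toSite (0, 1)) (toSite (0, 0)) =
      0 := by
  refine sHET_eq_zero u v σ (toSite (0, 0)) fun γ => ?_
  rw [enum_P_1_0_2 γ]; decide

/-- Value of the stiffness mid-edge observable at one of the four edges at the origin, on the explicit domain. [folklore] -/
private theorem sF_P_1_0_N (u v : ℂ) (σ : ℝ) :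
    stiffnessMidEdgeObservable (Omega PE) 1 (toSite (1, 0)) u v σ s(toSite (0, 0), toSite (0, 1)) =
      u * (tOf σ)⁻¹ := by
  simp only [stiffnessMidEdgeObservable_mk, sHET_P_1_0_N_out, sHET_P_1_0_N_in, add_zero]

/-- Value of one half-edge term of the stiffness observable on the explicit domain (enumeration certificate + integer turn/winding counts). [folklore] -/
private theorem sHET_P_1_0_W_out (u v : ℂ) (σ : ℝ) :
    stiffnessHalfEdgeTerm (Omega PE) 1 (toSite (1, 0)) u v σ (toSite (0, 0)) (toSite (-1, 0)) =
      v := by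
  rw [sHET_eq_single u v σ (toSite (-1, 0)) w_P_1_0_0_0 (fun γ hγ => absurd (enum_P_1_0_0 γ) hγ)]
  rw [if_neg (by decide), winding_support_medial w_P_1_0_0_0.walk (toSite (-1, 0)) (by decide),
    show quarterTurns (List.map ofSite w_P_1_0_0_0.walk.support ++ [ofSite (toSite (-1, 0))]) = 0 from by decide,
    show turnCount (w_P_1_0_0_0.walk.support ++ [toSite (-1, 0)]) = 0 from by decide,
    show straightCount (w_P_1_0_0_0.walk.support ++ [toSite (-1, 0)]) = 1 from by decide, cexp_quarter_0 σ]
  ring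

/-- Value of one half-edge term of the stiffness observable on the explicit domain (enumeration certificate + integer turn/winding counts). [folklore] -/
private theorem sHET_P_1_0_W_in (u v : ℂ) (σ : ℝ) :
    stiffnessHalfEdgeTerm (Omega PE) 1 (toSite (1, 0)) u v σ (toSite (-1, 0)) (toSite (0, 0)) =
      0 := by
  refine sHET_eq_zero u v σ (toSite (0, 0)) fun γ => ?_
  rw [enum_P_1_0_3 γ]; decide

/-- Value of the stiffness mid-edge observable at one of the four edges at the origin, on the explicit domain. [folklore] -/
private theorem sF_P_1_0_W (u v : ℂ) (σ : ℝ) :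
    stiffnessMidEdgeObservable (Omega PE) 1 (toSite (1, 0)) u v σ s(toSite (0, 0), toSite (-1, 0)) =
      v := by
  simp only [stiffnessMidEdgeObservable_mk, sHET_P_1_0_W_out, sHET_P_1_0_W_in, add_zero]

/-- Value of one half-edge term of the stiffness observable on the explicit domain (enumeration certificate + integer turn/winding counts). [folklore] -/
private theorem sHET_P_1_0_S_out (u v : ℂ) (σ : ℝ) :
    stiffnessHalfEdgeTerm (Omega PE) 1 (toSite (1, 0)) u v σ (toSite (0, 0)) (toSite (0, -1)) =
      u * tOf σ := by
  rw [sHET_eq_single u v σ (toSite (0, -1)) w_P_1_0_0_0 (fun γ hγ => absurd (enum_P_1_0_0 γ) hγ)]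
  rw [if_neg (by decide), winding_support_medial w_P_1_0_0_0.walk (toSite (0, -1)) (by decide),
    show quarterTurns (List.map ofSite w_P_1_0_0_0.walk.support ++ [ofSite (toSite (0, -1))]) = 1 from by decide,
    show turnCount (w_P_1_0_0_0.walk.support ++ [toSite (0, -1)]) = 1 from by decide,
    show straightCount (w_P_1_0_0_0.walk.support ++ [toSite (0, -1)]) = 0 from by decide, cexp_quarter_1 σ]
  ring

/-- Value of one half-edge term of the stiffness observable on the explicit domain (enumeration certificate + integer turn/winding counts). [folklore] -/
private theorem sHET_P_1_0_S_in (u v : ℂ) (σ : ℝ) :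
    stiffnessHalfEdgeTerm (Omega PE) 1 (toSite (1, 0)) u v σ (toSite (0, -1)) (toSite (0, 0)) =
      0 := by
  refine sHET_eq_zero u v σ (toSite (0, 0)) fun γ => ?_
  rw [enum_P_1_0_4 γ]; decide

/-- Value of the stiffness mid-edge observable at one of the four edges at the origin, on the explicit domain. [folklore] -/
private theorem sF_P_1_0_S (u v : ℂ) (σ : ℝ) :
    stiffnessMidEdgeObservable (Omega PE) 1 (toSite (1, 0)) u v σ s(toSite (0, 0), toSite (0, -1)) =
      u * tOf σ := by
  simp only [stiffnessMidEdgeObservable_mk, sHET_P_1_0_S_out, sHET_P_1_0_S_in, add_zero]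

/-- The stiffness vertex relation instantiated on domain `P` with root `(1, 0)`. [folklore] -/
private theorem sinst_P_1_0 {u v : ℂ} {σ : ℝ} {c : Fin 4 → ℂ} (hrel : ExactVertexRelationZ2Stiffness u v σ c) :
    c 0 * (1) + c 1 * (u * (tOf σ)⁻¹) + c 2 * (v) + c 3 * (u * tOf σ) = 0 := by
  have h := hrel (Omega PE) 1 (toSite (1, 0)) (toSite (0, 0)) one_pos
    ((goodP.mem_meshDomain_iff _).2 (by decide))
    ⟨toSite (2, 0), zdAdj_toSite_right (1, 0), by
      rw [meshPoint_one_toSite, pt_mem_Omega_iff goodP.unit]; decide⟩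
    (adj_four goodP (by decide) (by decide) (by decide) (by decide))
  rw [sum_four_dirZ2] at h
  rw [sF_P_1_0_E, sF_P_1_0_N, sF_P_1_0_W, sF_P_1_0_S] at h
  linear_combination h

/-! #### Instance `P`, root `(0, 1)` — stiffness observable -/

/-- Value of one half-edge term of the stiffness observable on the explicit domain (enumeration certificate + integer turn/winding counts). [folklore] -/
private theorem sHET_P_0_1_E_out (u v : ℂ) (σ : ℝ) :
    stiffnessHalfEdgeTerm (Omega PE) 1 (toSite (0, 1)) u v σ (toSite (0, 0)) (toSite (1, 0)) =
      u * tOf σ := by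
  rw [sHET_eq_single u v σ (toSite (1, 0)) w_P_0_1_0_0 (fun γ hγ => absurd (enum_P_0_1_0 γ) hγ)]
  rw [if_neg (by decide), winding_support_medial w_P_0_1_0_0.walk (toSite (1, 0)) (by decide),
    show quarterTurns (List.map ofSite w_P_0_1_0_0.walk.support ++ [ofSite (toSite (1, 0))]) = 1 from by decide,
    show turnCount (w_P_0_1_0_0.walk.support ++ [toSite (1, 0)]) = 1 from by decide,
    show straightCount (w_P_0_1_0_0.walk.support ++ [toSite (1, 0)]) = 0 from by decide, cexp_quarter_1 σ]
  ring

/-- Value of one half-edge term of the stiffness observable on the explicit domain (enumeration certificate + integer turn/winding counts). [folklore] -/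
private theorem sHET_P_0_1_E_in (u v : ℂ) (σ : ℝ) :
    stiffnessHalfEdgeTerm (Omega PE) 1 (toSite (0, 1)) u v σ (toSite (1, 0)) (toSite (0, 0)) =
      0 := by
  refine sHET_eq_zero u v σ (toSite (0, 0)) fun γ => ?_
  rw [enum_P_0_1_1 γ]; decide

/-- Value of the stiffness mid-edge observable at one of the four edges at the origin, on the explicit domain. [folklore] -/
private theorem sF_P_0_1_E (u v : ℂ) (σ : ℝ) :
    stiffnessMidEdgeObservable (Omega PE) 1 (toSite (0, 1)) u v σ s(toSite (0, 0), toSite (1, 0)) =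
      u * tOf σ := by
  simp only [stiffnessMidEdgeObservable_mk, sHET_P_0_1_E_out, sHET_P_0_1_E_in, add_zero]

/-- Value of one half-edge term of the stiffness observable on the explicit domain (enumeration certificate + integer turn/winding counts). [folklore] -/
private theorem sHET_P_0_1_N_out (u v : ℂ) (σ : ℝ) :
    stiffnessHalfEdgeTerm (Omega PE) 1 (toSite (0, 1)) u v σ (toSite (0, 0)) (toSite (0, 1)) =
      0 := by
  refine sHET_eq_zero u v σ (toSite (0, 1)) fun γ => ?_
  rw [enum_P_0_1_0 γ]; decide

/-- Value of one half-edge term of the stiffness observable on the explicit domain (enumeration certificate + integer turn/winding counts). [folklore] -/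
private theorem sHET_P_0_1_N_in (u v : ℂ) (σ : ℝ) :
    stiffnessHalfEdgeTerm (Omega PE) 1 (toSite (0, 1)) u v σ (toSite (0, 1)) (toSite (0, 0)) =
      1 := by
  rw [sHET_eq_single u v σ (toSite (0, 0)) nil_P_0_1 (fun γ hγ => absurd (enum_P_0_1_2 γ) hγ)]
  rw [if_neg (by decide), winding_support_medial nil_P_0_1.walk (toSite (0, 0)) (by decide),
    show quarterTurns (List.map ofSite nil_P_0_1.walk.support ++ [ofSite (toSite (0, 0))]) = 0 from by decide,
    show turnCount (nil_P_0_1.walk.support ++ [toSite (0, 0)]) = 0 from by decide,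
    show straightCount (nil_P_0_1.walk.support ++ [toSite (0, 0)]) = 0 from by decide, cexp_quarter_0 σ]
  ring

/-- Value of the stiffness mid-edge observable at one of the four edges at the origin, on the explicit domain. [folklore] -/
private theorem sF_P_0_1_N (u v : ℂ) (σ : ℝ) :
    stiffnessMidEdgeObservable (Omega PE) 1 (toSite (0, 1)) u v σ s(toSite (0, 0), toSite (0, 1)) =
      1 := by
  simp only [stiffnessMidEdgeObservable_mk, sHET_P_0_1_N_out, sHET_P_0_1_N_in, zero_add]

/-- Value of one half-edge term of the stiffness observable on the explicit domain (enumeration certificate + integer turn/winding counts). [folklore] -/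
private theorem sHET_P_0_1_W_out (u v : ℂ) (σ : ℝ) :
    stiffnessHalfEdgeTerm (Omega PE) 1 (toSite (0, 1)) u v σ (toSite (0, 0)) (toSite (-1, 0)) =
      u * (tOf σ)⁻¹ := by
  rw [sHET_eq_single u v σ (toSite (-1, 0)) w_P_0_1_0_0 (fun γ hγ => absurd (enum_P_0_1_0 γ) hγ)]
  rw [if_neg (by decide), winding_support_medial w_P_0_1_0_0.walk (toSite (-1, 0)) (by decide),
    show quarterTurns (List.map ofSite w_P_0_1_0_0.walk.support ++ [ofSite (toSite (-1, 0))]) = -1 from by decide,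
    show turnCount (w_P_0_1_0_0.walk.support ++ [toSite (-1, 0)]) = 1 from by decide,
    show straightCount (w_P_0_1_0_0.walk.support ++ [toSite (-1, 0)]) = 0 from by decide, cexp_quarter_m1 σ]
  ring

/-- Value of one half-edge term of the stiffness observable on the explicit domain (enumeration certificate + integer turn/winding counts). [folklore] -/
private theorem sHET_P_0_1_W_in (u v : ℂ) (σ : ℝ) :
    stiffnessHalfEdgeTerm (Omega PE) 1 (toSite (0, 1)) u v σ (toSite (-1, 0)) (toSite (0, 0)) =
      0 := by
  refine sHET_eq_zero u v σ (toSite (0, 0)) fun γ => ?_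
  rw [enum_P_0_1_3 γ]; decide

/-- Value of the stiffness mid-edge observable at one of the four edges at the origin, on the explicit domain. [folklore] -/
private theorem sF_P_0_1_W (u v : ℂ) (σ : ℝ) :
    stiffnessMidEdgeObservable (Omega PE) 1 (toSite (0, 1)) u v σ s(toSite (0, 0), toSite (-1, 0)) =
      u * (tOf σ)⁻¹ := by
  simp only [stiffnessMidEdgeObservable_mk, sHET_P_0_1_W_out, sHET_P_0_1_W_in, add_zero]

/-- Value of one half-edge term of the stiffness observable on the explicit domain (enumeration certificate + integer turn/winding counts). [folklore] -/
private theorem sHET_P_0_1_S_out (u v : ℂ) (σ : ℝ) :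
    stiffnessHalfEdgeTerm (Omega PE) 1 (toSite (0, 1)) u v σ (toSite (0, 0)) (toSite (0, -1)) =
      v := by
  rw [sHET_eq_single u v σ (toSite (0, -1)) w_P_0_1_0_0 (fun γ hγ => absurd (enum_P_0_1_0 γ) hγ)]
  rw [if_neg (by decide), winding_support_medial w_P_0_1_0_0.walk (toSite (0, -1)) (by decide),
    show quarterTurns (List.map ofSite w_P_0_1_0_0.walk.support ++ [ofSite (toSite (0, -1))]) = 0 from by decide,
    show turnCount (w_P_0_1_0_0.walk.support ++ [toSite (0, -1)]) = 0 from by decide,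
    show straightCount (w_P_0_1_0_0.walk.support ++ [toSite (0, -1)]) = 1 from by decide, cexp_quarter_0 σ]
  ring

/-- Value of one half-edge term of the stiffness observable on the explicit domain (enumeration certificate + integer turn/winding counts). [folklore] -/
private theorem sHET_P_0_1_S_in (u v : ℂ) (σ : ℝ) :
    stiffnessHalfEdgeTerm (Omega PE) 1 (toSite (0, 1)) u v σ (toSite (0, -1)) (toSite (0, 0)) =
      0 := by
  refine sHET_eq_zero u v σ (toSite (0, 0)) fun γ => ?_
  rw [enum_P_0_1_4 γ]; decide

/-- Value of the stiffness mid-edge observable at one of the four edges at the origin, on the explicit domain. [folklore] -/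
private theorem sF_P_0_1_S (u v : ℂ) (σ : ℝ) :
    stiffnessMidEdgeObservable (Omega PE) 1 (toSite (0, 1)) u v σ s(toSite (0, 0), toSite (0, -1)) =
      v := by
  simp only [stiffnessMidEdgeObservable_mk, sHET_P_0_1_S_out, sHET_P_0_1_S_in, add_zero]

/-- The stiffness vertex relation instantiated on domain `P` with root `(0, 1)`. [folklore] -/
private theorem sinst_P_0_1 {u v : ℂ} {σ : ℝ} {c : Fin 4 → ℂ} (hrel : ExactVertexRelationZ2Stiffness u v σ c) :
    c 0 * (u * tOf σ) + c 1 * (1) + c 2 * (u * (tOf σ)⁻¹) + c 3 * (v) = 0 := by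
  have h := hrel (Omega PE) 1 (toSite (0, 1)) (toSite (0, 0)) one_pos
    ((goodP.mem_meshDomain_iff _).2 (by decide))
    ⟨toSite (0, 2), zdAdj_toSite_up (0, 1), by
      rw [meshPoint_one_toSite, pt_mem_Omega_iff goodP.unit]; decide⟩
    (adj_four goodP (by decide) (by decide) (by decide) (by decide))
  rw [sum_four_dirZ2] at h
  rw [sF_P_0_1_E, sF_P_0_1_N, sF_P_0_1_W, sF_P_0_1_S] at h
  linear_combination h

/-! #### Instance `P`, root `(-1, 0)` — stiffness observable -/

/-- Value of one half-edge term of the stiffness observable on the explicit domain (enumeration certificate + integer turn/winding counts). [folklore] -/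
private theorem sHET_P_m1_0_E_out (u v : ℂ) (σ : ℝ) :
    stiffnessHalfEdgeTerm (Omega PE) 1 (toSite (-1, 0)) u v σ (toSite (0, 0)) (toSite (1, 0)) =
      v := by
  rw [sHET_eq_single u v σ (toSite (1, 0)) w_P_m1_0_0_0 (fun γ hγ => absurd (enum_P_m1_0_0 γ) hγ)]
  rw [if_neg (by decide), winding_support_medial w_P_m1_0_0_0.walk (toSite (1, 0)) (by decide),
    show quarterTurns (List.map ofSite w_P_m1_0_0_0.walk.support ++ [ofSite (toSite (1, 0))]) = 0 from by decide,
    show turnCount (w_P_m1_0_0_0.walk.support ++ [toSite (1, 0)]) = 0 from by decide,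
    show straightCount (w_P_m1_0_0_0.walk.support ++ [toSite (1, 0)]) = 1 from by decide, cexp_quarter_0 σ]
  ring

/-- Value of one half-edge term of the stiffness observable on the explicit domain (enumeration certificate + integer turn/winding counts). [folklore] -/
private theorem sHET_P_m1_0_E_in (u v : ℂ) (σ : ℝ) :
    stiffnessHalfEdgeTerm (Omega PE) 1 (toSite (-1, 0)) u v σ (toSite (1, 0)) (toSite (0, 0)) =
      0 := by
  refine sHET_eq_zero u v σ (toSite (0, 0)) fun γ => ?_
  rw [enum_P_m1_0_1 γ]; decide

/-- Value of the stiffness mid-edge observable at one of the four edges at the origin, on the explicit domain. [folklore] -/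
private theorem sF_P_m1_0_E (u v : ℂ) (σ : ℝ) :
    stiffnessMidEdgeObservable (Omega PE) 1 (toSite (-1, 0)) u v σ s(toSite (0, 0), toSite (1, 0)) =
      v := by
  simp only [stiffnessMidEdgeObservable_mk, sHET_P_m1_0_E_out, sHET_P_m1_0_E_in, add_zero]

/-- Value of one half-edge term of the stiffness observable on the explicit domain (enumeration certificate + integer turn/winding counts). [folklore] -/
private theorem sHET_P_m1_0_N_out (u v : ℂ) (σ : ℝ) :
    stiffnessHalfEdgeTerm (Omega PE) 1 (toSite (-1, 0)) u v σ (toSite (0, 0)) (toSite (0, 1)) =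
      u * tOf σ := by
  rw [sHET_eq_single u v σ (toSite (0, 1)) w_P_m1_0_0_0 (fun γ hγ => absurd (enum_P_m1_0_0 γ) hγ)]
  rw [if_neg (by decide), winding_support_medial w_P_m1_0_0_0.walk (toSite (0, 1)) (by decide),
    show quarterTurns (List.map ofSite w_P_m1_0_0_0.walk.support ++ [ofSite (toSite (0, 1))]) = 1 from by decide,
    show turnCount (w_P_m1_0_0_0.walk.support ++ [toSite (0, 1)]) = 1 from by decide,
    show straightCount (w_P_m1_0_0_0.walk.support ++ [toSite (0, 1)]) = 0 from by decide, cexp_quarter_1 σ]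
  ring

/-- Value of one half-edge term of the stiffness observable on the explicit domain (enumeration certificate + integer turn/winding counts). [folklore] -/
private theorem sHET_P_m1_0_N_in (u v : ℂ) (σ : ℝ) :
    stiffnessHalfEdgeTerm (Omega PE) 1 (toSite (-1, 0)) u v σ (toSite (0, 1)) (toSite (0, 0)) =
      0 := by
  refine sHET_eq_zero u v σ (toSite (0, 0)) fun γ => ?_
  rw [enum_P_m1_0_2 γ]; decide

/-- Value of the stiffness mid-edge observable at one of the four edges at the origin, on the explicit domain. [folklore] -/
private theorem sF_P_m1_0_N (u v : ℂ) (σ : ℝ) :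
    stiffnessMidEdgeObservable (Omega PE) 1 (toSite (-1, 0)) u v σ s(toSite (0, 0), toSite (0, 1)) =
      u * tOf σ := by
  simp only [stiffnessMidEdgeObservable_mk, sHET_P_m1_0_N_out, sHET_P_m1_0_N_in, add_zero]

/-- Value of one half-edge term of the stiffness observable on the explicit domain (enumeration certificate + integer turn/winding counts). [folklore] -/
private theorem sHET_P_m1_0_W_out (u v : ℂ) (σ : ℝ) :
    stiffnessHalfEdgeTerm (Omega PE) 1 (toSite (-1, 0)) u v σ (toSite (0, 0)) (toSite (-1, 0)) =
      0 := by
  refine sHET_eq_zero u v σ (toSite (-1, 0)) fun γ => ?_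
  rw [enum_P_m1_0_0 γ]; decide

/-- Value of one half-edge term of the stiffness observable on the explicit domain (enumeration certificate + integer turn/winding counts). [folklore] -/
private theorem sHET_P_m1_0_W_in (u v : ℂ) (σ : ℝ) :
    stiffnessHalfEdgeTerm (Omega PE) 1 (toSite (-1, 0)) u v σ (toSite (-1, 0)) (toSite (0, 0)) =
      1 := by
  rw [sHET_eq_single u v σ (toSite (0, 0)) nil_P_m1_0 (fun γ hγ => absurd (enum_P_m1_0_3 γ) hγ)]
  rw [if_neg (by decide), winding_support_medial nil_P_m1_0.walk (toSite (0, 0)) (by decide),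
    show quarterTurns (List.map ofSite nil_P_m1_0.walk.support ++ [ofSite (toSite (0, 0))]) = 0 from by decide,
    show turnCount (nil_P_m1_0.walk.support ++ [toSite (0, 0)]) = 0 from by decide,
    show straightCount (nil_P_m1_0.walk.support ++ [toSite (0, 0)]) = 0 from by decide, cexp_quarter_0 σ]
  ring

/-- Value of the stiffness mid-edge observable at one of the four edges at the origin, on the explicit domain. [folklore] -/
private theorem sF_P_m1_0_W (u v : ℂ) (σ : ℝ) :
    stiffnessMidEdgeObservable (Omega PE) 1 (toSite (-1, 0)) u v σ s(toSite (0, 0), toSite (-1, 0)) =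
      1 := by
  simp only [stiffnessMidEdgeObservable_mk, sHET_P_m1_0_W_out, sHET_P_m1_0_W_in, zero_add]

/-- Value of one half-edge term of the stiffness observable on the explicit domain (enumeration certificate + integer turn/winding counts). [folklore] -/
private theorem sHET_P_m1_0_S_out (u v : ℂ) (σ : ℝ) :
    stiffnessHalfEdgeTerm (Omega PE) 1 (toSite (-1, 0)) u v σ (toSite (0, 0)) (toSite (0, -1)) =
      u * (tOf σ)⁻¹ := by
  rw [sHET_eq_single u v σ (toSite (0, -1)) w_P_m1_0_0_0 (fun γ hγ => absurd (enum_P_m1_0_0 γ) hγ)]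
  rw [if_neg (by decide), winding_support_medial w_P_m1_0_0_0.walk (toSite (0, -1)) (by decide),
    show quarterTurns (List.map ofSite w_P_m1_0_0_0.walk.support ++ [ofSite (toSite (0, -1))]) = -1 from by decide,
    show turnCount (w_P_m1_0_0_0.walk.support ++ [toSite (0, -1)]) = 1 from by decide,
    show straightCount (w_P_m1_0_0_0.walk.support ++ [toSite (0, -1)]) = 0 from by decide, cexp_quarter_m1 σ]
  ring

/-- Value of one half-edge term of the stiffness observable on the explicit domain (enumeration certificate + integer turn/winding counts). [folklore] -/
private theorem sHET_P_m1_0_S_in (u v : ℂ) (σ : ℝ) :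
    stiffnessHalfEdgeTerm (Omega PE) 1 (toSite (-1, 0)) u v σ (toSite (0, -1)) (toSite (0, 0)) =
      0 := by
  refine sHET_eq_zero u v σ (toSite (0, 0)) fun γ => ?_
  rw [enum_P_m1_0_4 γ]; decide

/-- Value of the stiffness mid-edge observable at one of the four edges at the origin, on the explicit domain. [folklore] -/
private theorem sF_P_m1_0_S (u v : ℂ) (σ : ℝ) :
    stiffnessMidEdgeObservable (Omega PE) 1 (toSite (-1, 0)) u v σ s(toSite (0, 0), toSite (0, -1)) =
      u * (tOf σ)⁻¹ := by
  simp only [stiffnessMidEdgeObservable_mk, sHET_P_m1_0_S_out, sHET_P_m1_0_S_in, add_zero]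

/-- The stiffness vertex relation instantiated on domain `P` with root `(-1, 0)`. [folklore] -/
private theorem sinst_P_m1_0 {u v : ℂ} {σ : ℝ} {c : Fin 4 → ℂ} (hrel : ExactVertexRelationZ2Stiffness u v σ c) :
    c 0 * (v) + c 1 * (u * tOf σ) + c 2 * (1) + c 3 * (u * (tOf σ)⁻¹) = 0 := by
  have h := hrel (Omega PE) 1 (toSite (-1, 0)) (toSite (0, 0)) one_pos
    ((goodP.mem_meshDomain_iff _).2 (by decide))
    ⟨toSite (-2, 0), zdAdj_toSite_left (-1, 0), by
      rw [meshPoint_one_toSite, pt_mem_Omega_iff goodP.unit]; decide⟩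
    (adj_four goodP (by decide) (by decide) (by decide) (by decide))
  rw [sum_four_dirZ2] at h
  rw [sF_P_m1_0_E, sF_P_m1_0_N, sF_P_m1_0_W, sF_P_m1_0_S] at h
  linear_combination h

/-! #### Instance `P`, root `(0, -1)` — stiffness observable -/

/-- Value of one half-edge term of the stiffness observable on the explicit domain (enumeration certificate + integer turn/winding counts). [folklore] -/
private theorem sHET_P_0_m1_E_out (u v : ℂ) (σ : ℝ) :
    stiffnessHalfEdgeTerm (Omega PE) 1 (toSite (0, -1)) u v σ (toSite (0, 0)) (toSite (1, 0)) =
      u * (tOf σ)⁻¹ := by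
  rw [sHET_eq_single u v σ (toSite (1, 0)) w_P_0_m1_0_0 (fun γ hγ => absurd (enum_P_0_m1_0 γ) hγ)]
  rw [if_neg (by decide), winding_support_medial w_P_0_m1_0_0.walk (toSite (1, 0)) (by decide),
    show quarterTurns (List.map ofSite w_P_0_m1_0_0.walk.support ++ [ofSite (toSite (1, 0))]) = -1 from by decide,
    show turnCount (w_P_0_m1_0_0.walk.support ++ [toSite (1, 0)]) = 1 from by decide,
    show straightCount (w_P_0_m1_0_0.walk.support ++ [toSite (1, 0)]) = 0 from by decide, cexp_quarter_m1 σ]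
  ring

/-- Value of one half-edge term of the stiffness observable on the explicit domain (enumeration certificate + integer turn/winding counts). [folklore] -/
private theorem sHET_P_0_m1_E_in (u v : ℂ) (σ : ℝ) :
    stiffnessHalfEdgeTerm (Omega PE) 1 (toSite (0, -1)) u v σ (toSite (1, 0)) (toSite (0, 0)) =
      0 := by
  refine sHET_eq_zero u v σ (toSite (0, 0)) fun γ => ?_
  rw [enum_P_0_m1_1 γ]; decide

/-- Value of the stiffness mid-edge observable at one of the four edges at the origin, on the explicit domain. [folklore] -/
private theorem sF_P_0_m1_E (u v : ℂ) (σ : ℝ) :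
    stiffnessMidEdgeObservable (Omega PE) 1 (toSite (0, -1)) u v σ s(toSite (0, 0), toSite (1, 0)) =
      u * (tOf σ)⁻¹ := by
  simp only [stiffnessMidEdgeObservable_mk, sHET_P_0_m1_E_out, sHET_P_0_m1_E_in, add_zero]

/-- Value of one half-edge term of the stiffness observable on the explicit domain (enumeration certificate + integer turn/winding counts). [folklore] -/
private theorem sHET_P_0_m1_N_out (u v : ℂ) (σ : ℝ) :
    stiffnessHalfEdgeTerm (Omega PE) 1 (toSite (0, -1)) u v σ (toSite (0, 0)) (toSite (0, 1)) =
      v := by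
  rw [sHET_eq_single u v σ (toSite (0, 1)) w_P_0_m1_0_0 (fun γ hγ => absurd (enum_P_0_m1_0 γ) hγ)]
  rw [if_neg (by decide), winding_support_medial w_P_0_m1_0_0.walk (toSite (0, 1)) (by decide),
    show quarterTurns (List.map ofSite w_P_0_m1_0_0.walk.support ++ [ofSite (toSite (0, 1))]) = 0 from by decide,
    show turnCount (w_P_0_m1_0_0.walk.support ++ [toSite (0, 1)]) = 0 from by decide,
    show straightCount (w_P_0_m1_0_0.walk.support ++ [toSite (0, 1)]) = 1 from by decide, cexp_quarter_0 σ]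
  ring

/-- Value of one half-edge term of the stiffness observable on the explicit domain (enumeration certificate + integer turn/winding counts). [folklore] -/
private theorem sHET_P_0_m1_N_in (u v : ℂ) (σ : ℝ) :
    stiffnessHalfEdgeTerm (Omega PE) 1 (toSite (0, -1)) u v σ (toSite (0, 1)) (toSite (0, 0)) =
      0 := by
  refine sHET_eq_zero u v σ (toSite (0, 0)) fun γ => ?_
  rw [enum_P_0_m1_2 γ]; decide

/-- Value of the stiffness mid-edge observable at one of the four edges at the origin, on the explicit domain. [folklore] -/
private theorem sF_P_0_m1_N (u v : ℂ) (σ : ℝ) :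
    stiffnessMidEdgeObservable (Omega PE) 1 (toSite (0, -1)) u v σ s(toSite (0, 0), toSite (0, 1)) =
      v := by
  simp only [stiffnessMidEdgeObservable_mk, sHET_P_0_m1_N_out, sHET_P_0_m1_N_in, add_zero]

/-- Value of one half-edge term of the stiffness observable on the explicit domain (enumeration certificate + integer turn/winding counts). [folklore] -/
private theorem sHET_P_0_m1_W_out (u v : ℂ) (σ : ℝ) :
    stiffnessHalfEdgeTerm (Omega PE) 1 (toSite (0, -1)) u v σ (toSite (0, 0)) (toSite (-1, 0)) =
      u * tOf σ := by
  rw [sHET_eq_single u v σ (toSite (-1, 0)) w_P_0_m1_0_0 (fun γ hγ => absurd (enum_P_0_m1_0 γ) hγ)]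
  rw [if_neg (by decide), winding_support_medial w_P_0_m1_0_0.walk (toSite (-1, 0)) (by decide),
    show quarterTurns (List.map ofSite w_P_0_m1_0_0.walk.support ++ [ofSite (toSite (-1, 0))]) = 1 from by decide,
    show turnCount (w_P_0_m1_0_0.walk.support ++ [toSite (-1, 0)]) = 1 from by decide,
    show straightCount (w_P_0_m1_0_0.walk.support ++ [toSite (-1, 0)]) = 0 from by decide, cexp_quarter_1 σ]
  ring

/-- Value of one half-edge term of the stiffness observable on the explicit domain (enumeration certificate + integer turn/winding counts). [folklore] -/
private theorem sHET_P_0_m1_W_in (u v : ℂ) (σ : ℝ) :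
    stiffnessHalfEdgeTerm (Omega PE) 1 (toSite (0, -1)) u v σ (toSite (-1, 0)) (toSite (0, 0)) =
      0 := by
  refine sHET_eq_zero u v σ (toSite (0, 0)) fun γ => ?_
  rw [enum_P_0_m1_3 γ]; decide

/-- Value of the stiffness mid-edge observable at one of the four edges at the origin, on the explicit domain. [folklore] -/
private theorem sF_P_0_m1_W (u v : ℂ) (σ : ℝ) :
    stiffnessMidEdgeObservable (Omega PE) 1 (toSite (0, -1)) u v σ s(toSite (0, 0), toSite (-1, 0)) =
      u * tOf σ := by
  simp only [stiffnessMidEdgeObservable_mk, sHET_P_0_m1_W_out, sHET_P_0_m1_W_in, add_zero]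

/-- Value of one half-edge term of the stiffness observable on the explicit domain (enumeration certificate + integer turn/winding counts). [folklore] -/
private theorem sHET_P_0_m1_S_out (u v : ℂ) (σ : ℝ) :
    stiffnessHalfEdgeTerm (Omega PE) 1 (toSite (0, -1)) u v σ (toSite (0, 0)) (toSite (0, -1)) =
      0 := by
  refine sHET_eq_zero u v σ (toSite (0, -1)) fun γ => ?_
  rw [enum_P_0_m1_0 γ]; decide

/-- Value of one half-edge term of the stiffness observable on the explicit domain (enumeration certificate + integer turn/winding counts). [folklore] -/
private theorem sHET_P_0_m1_S_in (u v : ℂ) (σ : ℝ) :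
    stiffnessHalfEdgeTerm (Omega PE) 1 (toSite (0, -1)) u v σ (toSite (0, -1)) (toSite (0, 0)) =
      1 := by
  rw [sHET_eq_single u v σ (toSite (0, 0)) nil_P_0_m1 (fun γ hγ => absurd (enum_P_0_m1_4 γ) hγ)]
  rw [if_neg (by decide), winding_support_medial nil_P_0_m1.walk (toSite (0, 0)) (by decide),
    show quarterTurns (List.map ofSite nil_P_0_m1.walk.support ++ [ofSite (toSite (0, 0))]) = 0 from by decide,
    show turnCount (nil_P_0_m1.walk.support ++ [toSite (0, 0)]) = 0 from by decide,
    show straightCount (nil_P_0_m1.walk.support ++ [toSite (0, 0)]) = 0 from by decide, cexp_quarter_0 σ]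
  ring

/-- Value of the stiffness mid-edge observable at one of the four edges at the origin, on the explicit domain. [folklore] -/
private theorem sF_P_0_m1_S (u v : ℂ) (σ : ℝ) :
    stiffnessMidEdgeObservable (Omega PE) 1 (toSite (0, -1)) u v σ s(toSite (0, 0), toSite (0, -1)) =
      1 := by
  simp only [stiffnessMidEdgeObservable_mk, sHET_P_0_m1_S_out, sHET_P_0_m1_S_in, zero_add]

/-- The stiffness vertex relation instantiated on domain `P` with root `(0, -1)`. [folklore] -/
private theorem sinst_P_0_m1 {u v : ℂ} {σ : ℝ} {c : Fin 4 → ℂ} (hrel : ExactVertexRelationZ2Stiffness u v σ c) :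
    c 0 * (u * (tOf σ)⁻¹) + c 1 * (v) + c 2 * (u * tOf σ) + c 3 * (1) = 0 := by
  have h := hrel (Omega PE) 1 (toSite (0, -1)) (toSite (0, 0)) one_pos
    ((goodP.mem_meshDomain_iff _).2 (by decide))
    ⟨toSite (0, -2), zdAdj_toSite_down (0, -1), by
      rw [meshPoint_one_toSite, pt_mem_Omega_iff goodP.unit]; decide⟩
    (adj_four goodP (by decide) (by decide) (by decide) (by decide))
  rw [sum_four_dirZ2] at h
  rw [sF_P_0_m1_E, sF_P_0_m1_N, sF_P_0_m1_W, sF_P_0_m1_S] at h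
  linear_combination h

/-! #### Instance `T`, root `(1, 0)` — stiffness observable -/

/-- Value of one half-edge term of the stiffness observable on the explicit domain (enumeration certificate + integer turn/winding counts). [folklore] -/
private theorem sHET_T_1_0_E_out (u v : ℂ) (σ : ℝ) :
    stiffnessHalfEdgeTerm (Omega TE) 1 (toSite (1, 0)) u v σ (toSite (0, 0)) (toSite (1, 0)) =
      0 := by
  refine sHET_eq_zero u v σ (toSite (1, 0)) fun γ => ?_
  rw [enum_T_1_0_0 γ]; decide

/-- Value of one half-edge term of the stiffness observable on the explicit domain (enumeration certificate + integer turn/winding counts). [folklore] -/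
private theorem sHET_T_1_0_E_in (u v : ℂ) (σ : ℝ) :
    stiffnessHalfEdgeTerm (Omega TE) 1 (toSite (1, 0)) u v σ (toSite (1, 0)) (toSite (0, 0)) =
      1 := by
  rw [sHET_eq_single u v σ (toSite (0, 0)) nil_T_1_0 (fun γ hγ => absurd (enum_T_1_0_1 γ) hγ)]
  rw [if_neg (by decide), winding_support_medial nil_T_1_0.walk (toSite (0, 0)) (by decide),
    show quarterTurns (List.map ofSite nil_T_1_0.walk.support ++ [ofSite (toSite (0, 0))]) = 0 from by decide,
    show turnCount (nil_T_1_0.walk.support ++ [toSite (0, 0)]) = 0 from by decide,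
    show straightCount (nil_T_1_0.walk.support ++ [toSite (0, 0)]) = 0 from by decide, cexp_quarter_0 σ]
  ring

/-- Value of the stiffness mid-edge observable at one of the four edges at the origin, on the explicit domain. [folklore] -/
private theorem sF_T_1_0_E (u v : ℂ) (σ : ℝ) :
    stiffnessMidEdgeObservable (Omega TE) 1 (toSite (1, 0)) u v σ s(toSite (0, 0), toSite (1, 0)) =
      1 := by
  simp only [stiffnessMidEdgeObservable_mk, sHET_T_1_0_E_out, sHET_T_1_0_E_in, zero_add]

/-- Value of one half-edge term of the stiffness observable on the explicit domain (enumeration certificate + integer turn/winding counts). [folklore] -/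
private theorem sHET_T_1_0_N_out (u v : ℂ) (σ : ℝ) :
    stiffnessHalfEdgeTerm (Omega TE) 1 (toSite (1, 0)) u v σ (toSite (0, 0)) (toSite (0, 1)) =
      u * (tOf σ)⁻¹ := by
  rw [sHET_eq_single u v σ (toSite (0, 1)) w_T_1_0_0_0 (fun γ hγ => absurd (enum_T_1_0_0 γ) hγ)]
  rw [if_neg (by decide), winding_support_medial w_T_1_0_0_0.walk (toSite (0, 1)) (by decide),
    show quarterTurns (List.map ofSite w_T_1_0_0_0.walk.support ++ [ofSite (toSite (0, 1))]) = -1 from by decide,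
    show turnCount (w_T_1_0_0_0.walk.support ++ [toSite (0, 1)]) = 1 from by decide,
    show straightCount (w_T_1_0_0_0.walk.support ++ [toSite (0, 1)]) = 0 from by decide, cexp_quarter_m1 σ]
  ring

/-- Value of one half-edge term of the stiffness observable on the explicit domain (enumeration certificate + integer turn/winding counts). [folklore] -/
private theorem sHET_T_1_0_N_in (u v : ℂ) (σ : ℝ) :
    stiffnessHalfEdgeTerm (Omega TE) 1 (toSite (1, 0)) u v σ (toSite (0, 1)) (toSite (0, 0)) =
      u ^ 3 * v ^ 5 * (tOf σ)⁻¹ ^ 3 := by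
  rw [sHET_eq_single u v σ (toSite (0, 0)) w_T_1_0_2_1 (fun γ hγ => by
    rcases enum_T_1_0_2 γ with rfl | rfl
    · decide
    · exact absurd rfl hγ
    )]
  rw [if_neg (by decide), winding_support_medial w_T_1_0_2_1.walk (toSite (0, 0)) (by decide),
    show quarterTurns (List.map ofSite w_T_1_0_2_1.walk.support ++ [ofSite (toSite (0, 0))]) = -3 from by decide,
    show turnCount (w_T_1_0_2_1.walk.support ++ [toSite (0, 0)]) = 3 from by decide,
    show straightCount (w_T_1_0_2_1.walk.support ++ [toSite (0, 0)]) = 5 from by decide, cexp_quarter_m3 σ]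
  ring

/-- Value of the stiffness mid-edge observable at one of the four edges at the origin, on the explicit domain. [folklore] -/
private theorem sF_T_1_0_N (u v : ℂ) (σ : ℝ) :
    stiffnessMidEdgeObservable (Omega TE) 1 (toSite (1, 0)) u v σ s(toSite (0, 0), toSite (0, 1)) =
      u * (tOf σ)⁻¹ + u ^ 3 * v ^ 5 * (tOf σ)⁻¹ ^ 3 := by
  simp only [stiffnessMidEdgeObservable_mk, sHET_T_1_0_N_out, sHET_T_1_0_N_in]

/-- Value of one half-edge term of the stiffness observable on the explicit domain (enumeration certificate + integer turn/winding counts). [folklore] -/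
private theorem sHET_T_1_0_W_out (u v : ℂ) (σ : ℝ) :
    stiffnessHalfEdgeTerm (Omega TE) 1 (toSite (1, 0)) u v σ (toSite (0, 0)) (toSite (-1, 0)) =
      v := by
  rw [sHET_eq_single u v σ (toSite (-1, 0)) w_T_1_0_0_0 (fun γ hγ => absurd (enum_T_1_0_0 γ) hγ)]
  rw [if_neg (by decide), winding_support_medial w_T_1_0_0_0.walk (toSite (-1, 0)) (by decide),
    show quarterTurns (List.map ofSite w_T_1_0_0_0.walk.support ++ [ofSite (toSite (-1, 0))]) = 0 from by decide,
    show turnCount (w_T_1_0_0_0.walk.support ++ [toSite (-1, 0)]) = 0 from by decide,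
    show straightCount (w_T_1_0_0_0.walk.support ++ [toSite (-1, 0)]) = 1 from by decide, cexp_quarter_0 σ]
  ring

/-- Value of one half-edge term of the stiffness observable on the explicit domain (enumeration certificate + integer turn/winding counts). [folklore] -/
private theorem sHET_T_1_0_W_in (u v : ℂ) (σ : ℝ) :
    stiffnessHalfEdgeTerm (Omega TE) 1 (toSite (1, 0)) u v σ (toSite (-1, 0)) (toSite (0, 0)) =
      u ^ 4 * v ^ 4 * tOf σ ^ 2 := by
  rw [sHET_eq_single u v σ (toSite (0, 0)) w_T_1_0_3_0 (fun γ hγ => by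
    rcases enum_T_1_0_3 γ with rfl | rfl
    · exact absurd rfl hγ
    · decide
    )]
  rw [if_neg (by decide), winding_support_medial w_T_1_0_3_0.walk (toSite (0, 0)) (by decide),
    show quarterTurns (List.map ofSite w_T_1_0_3_0.walk.support ++ [ofSite (toSite (0, 0))]) = 2 from by decide,
    show turnCount (w_T_1_0_3_0.walk.support ++ [toSite (0, 0)]) = 4 from by decide,
    show straightCount (w_T_1_0_3_0.walk.support ++ [toSite (0, 0)]) = 4 from by decide, cexp_quarter_2 σ]
  ring

/-- Value of the stiffness mid-edge observable at one of the four edges at the origin, on the explicit domain. [folklore] -/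
private theorem sF_T_1_0_W (u v : ℂ) (σ : ℝ) :
    stiffnessMidEdgeObservable (Omega TE) 1 (toSite (1, 0)) u v σ s(toSite (0, 0), toSite (-1, 0)) =
      v + u ^ 4 * v ^ 4 * tOf σ ^ 2 := by
  simp only [stiffnessMidEdgeObservable_mk, sHET_T_1_0_W_out, sHET_T_1_0_W_in]

/-- Value of one half-edge term of the stiffness observable on the explicit domain (enumeration certificate + integer turn/winding counts). [folklore] -/
private theorem sHET_T_1_0_S_out (u v : ℂ) (σ : ℝ) :
    stiffnessHalfEdgeTerm (Omega TE) 1 (toSite (1, 0)) u v σ (toSite (0, 0)) (toSite (0, -1)) =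
      u * tOf σ := by
  rw [sHET_eq_single u v σ (toSite (0, -1)) w_T_1_0_0_0 (fun γ hγ => absurd (enum_T_1_0_0 γ) hγ)]
  rw [if_neg (by decide), winding_support_medial w_T_1_0_0_0.walk (toSite (0, -1)) (by decide),
    show quarterTurns (List.map ofSite w_T_1_0_0_0.walk.support ++ [ofSite (toSite (0, -1))]) = 1 from by decide,
    show turnCount (w_T_1_0_0_0.walk.support ++ [toSite (0, -1)]) = 1 from by decide,
    show straightCount (w_T_1_0_0_0.walk.support ++ [toSite (0, -1)]) = 0 from by decide, cexp_quarter_1 σ]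
  ring

/-- Value of one half-edge term of the stiffness observable on the explicit domain (enumeration certificate + integer turn/winding counts). [folklore] -/
private theorem sHET_T_1_0_S_in (u v : ℂ) (σ : ℝ) :
    stiffnessHalfEdgeTerm (Omega TE) 1 (toSite (1, 0)) u v σ (toSite (0, -1)) (toSite (0, 0)) =
      0 := by
  refine sHET_eq_zero u v σ (toSite (0, 0)) fun γ => ?_
  rw [enum_T_1_0_4 γ]; decide

/-- Value of the stiffness mid-edge observable at one of the four edges at the origin, on the explicit domain. [folklore] -/
private theorem sF_T_1_0_S (u v : ℂ) (σ : ℝ) :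
    stiffnessMidEdgeObservable (Omega TE) 1 (toSite (1, 0)) u v σ s(toSite (0, 0), toSite (0, -1)) =
      u * tOf σ := by
  simp only [stiffnessMidEdgeObservable_mk, sHET_T_1_0_S_out, sHET_T_1_0_S_in, add_zero]

/-- The stiffness vertex relation instantiated on domain `T` with root `(1, 0)`. [folklore] -/
private theorem sinst_T_1_0 {u v : ℂ} {σ : ℝ} {c : Fin 4 → ℂ} (hrel : ExactVertexRelationZ2Stiffness u v σ c) :
    c 0 * (1) + c 1 * (u * (tOf σ)⁻¹ + u ^ 3 * v ^ 5 * (tOf σ)⁻¹ ^ 3) + c 2 * (v + u ^ 4 * v ^ 4 * tOf σ ^ 2) + c 3 * (u * tOf σ) = 0 := by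
  have h := hrel (Omega TE) 1 (toSite (1, 0)) (toSite (0, 0)) one_pos
    ((goodT.mem_meshDomain_iff _).2 (by decide))
    ⟨toSite (2, 0), zdAdj_toSite_right (1, 0), by
      rw [meshPoint_one_toSite, pt_mem_Omega_iff goodT.unit]; decide⟩
    (adj_four goodT (by decide) (by decide) (by decide) (by decide))
  rw [sum_four_dirZ2] at h
  rw [sF_T_1_0_E, sF_T_1_0_N, sF_T_1_0_W, sF_T_1_0_S] at h
  linear_combination h

/-! #### Instance `T`, root `(0, -1)` — stiffness observable -/

/-- explicit self-avoiding walk `(0,-1) → (0,0)` [folklore] -/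
private def w_T_0_m1_0_0 : Literature.Probability.RandomPlanarGeometry.SAW.DomainSAW (Omega TE) 1 (toSite (0, -1)) (toSite (0, 0)) :=
  ⟨SimpleGraph.Walk.cons (goodT.A (0, -1) (0, 0)) <|
  SimpleGraph.Walk.nil, (SimpleGraph.Walk.isPath_def _).2 (by decide)⟩

/-- Enumeration certificate: the self-avoiding walks of `Ω_E` between these endpoints are exactly the listed ones (completeness of `dfs` + `decide`). [folklore] -/
private theorem enum_T_0_m1_0 : ∀ γ : Literature.Probability.RandomPlanarGeometry.SAW.DomainSAW (Omega TE) 1 (toSite (0, -1)) (toSite (0, 0)),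
    γ = w_T_0_m1_0_0 := by
  intro γ
  have hmem := goodT.support_mem_dfs γ (by decide) (fuel := 20) (by decide)
  have hhead := head?_reverse_map_support γ.walk
  have hall : ∀ l ∈ dfs TE 20 [ofSite (toSite (0, -1))], l.head? = some (ofSite (toSite (0, 0))) →
      l = [(0, 0), (0, -1)] := by decide
  have h := hall _ hmem hhead
  apply DomainSAW_eq_of_support; rw [support_eq_of_reverse_map γ.walk h]; decide

/-- explicit self-avoiding walk `(0,-1) → (0,0) → (1,0)` [folklore] -/
private def w_T_0_m1_1_0 : Literature.Probability.RandomPlanarGeometry.SAW.DomainSAW (Omega TE) 1 (toSite (0, -1)) (toSite (1, 0)) :=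
  ⟨SimpleGraph.Walk.cons (goodT.A (0, -1) (0, 0)) <|
  SimpleGraph.Walk.cons (goodT.A (0, 0) (1, 0)) <|
  SimpleGraph.Walk.nil, (SimpleGraph.Walk.isPath_def _).2 (by decide)⟩

/-- Enumeration certificate: the self-avoiding walks of `Ω_E` between these endpoints are exactly the listed ones (completeness of `dfs` + `decide`). [folklore] -/
private theorem enum_T_0_m1_1 : ∀ γ : Literature.Probability.RandomPlanarGeometry.SAW.DomainSAW (Omega TE) 1 (toSite (0, -1)) (toSite (1, 0)),
    γ = w_T_0_m1_1_0 := by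
  intro γ
  have hmem := goodT.support_mem_dfs γ (by decide) (fuel := 20) (by decide)
  have hhead := head?_reverse_map_support γ.walk
  have hall : ∀ l ∈ dfs TE 20 [ofSite (toSite (0, -1))], l.head? = some (ofSite (toSite (1, 0))) →
      l = [(1, 0), (0, 0), (0, -1)] := by decide
  have h := hall _ hmem hhead
  apply DomainSAW_eq_of_support; rw [support_eq_of_reverse_map γ.walk h]; decide

/-- explicit self-avoiding walk `(0,-1) → (0,0) → (0,1)` [folklore] -/
private def w_T_0_m1_2_0 : Literature.Probability.RandomPlanarGeometry.SAW.DomainSAW (Omega TE) 1 (toSite (0, -1)) (toSite (0, 1)) :=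
  ⟨SimpleGraph.Walk.cons (goodT.A (0, -1) (0, 0)) <|
  SimpleGraph.Walk.cons (goodT.A (0, 0) (0, 1)) <|
  SimpleGraph.Walk.nil, (SimpleGraph.Walk.isPath_def _).2 (by decide)⟩

/-- explicit self-avoiding walk `(0,-1) → (0,0) → (-1,0) → (-2,0) → (-2,1) → (-2,2) → (-1,2) → (0,2) → (0,1)` [folklore] -/
private def w_T_0_m1_2_1 : Literature.Probability.RandomPlanarGeometry.SAW.DomainSAW (Omega TE) 1 (toSite (0, -1)) (toSite (0, 1)) :=
  ⟨SimpleGraph.Walk.cons (goodT.A (0, -1) (0, 0)) <|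
  SimpleGraph.Walk.cons (goodT.A (0, 0) (-1, 0)) <|
  SimpleGraph.Walk.cons (goodT.A (-1, 0) (-2, 0)) <|
  SimpleGraph.Walk.cons (goodT.A (-2, 0) (-2, 1)) <|
  SimpleGraph.Walk.cons (goodT.A (-2, 1) (-2, 2)) <|
  SimpleGraph.Walk.cons (goodT.A (-2, 2) (-1, 2)) <|
  SimpleGraph.Walk.cons (goodT.A (-1, 2) (0, 2)) <|
  SimpleGraph.Walk.cons (goodT.A (0, 2) (0, 1)) <|
  SimpleGraph.Walk.nil, (SimpleGraph.Walk.isPath_def _).2 (by decide)⟩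

/-- Enumeration certificate: the self-avoiding walks of `Ω_E` between these endpoints are exactly the listed ones (completeness of `dfs` + `decide`). [folklore] -/
private theorem enum_T_0_m1_2 : ∀ γ : Literature.Probability.RandomPlanarGeometry.SAW.DomainSAW (Omega TE) 1 (toSite (0, -1)) (toSite (0, 1)),
    γ = w_T_0_m1_2_0 ∨ γ = w_T_0_m1_2_1 := by
  intro γ
  have hmem := goodT.support_mem_dfs γ (by decide) (fuel := 20) (by decide)
  have hhead := head?_reverse_map_support γ.walk
  have hall : ∀ l ∈ dfs TE 20 [ofSite (toSite (0, -1))], l.head? = some (ofSite (toSite (0, 1))) →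
      l = [(0, 1), (0, 0), (0, -1)] ∨ l = [(0, 1), (0, 2), (-1, 2), (-2, 2), (-2, 1), (-2, 0), (-1, 0), (0, 0), (0, -1)] := by decide
  rcases hall _ hmem hhead with h | h
  · left; apply DomainSAW_eq_of_support; rw [support_eq_of_reverse_map γ.walk h]; decide
  · right; apply DomainSAW_eq_of_support; rw [support_eq_of_reverse_map γ.walk h]; decide

/-- explicit self-avoiding walk `(0,-1) → (0,0) → (-1,0)` [folklore] -/
private def w_T_0_m1_3_0 : Literature.Probability.RandomPlanarGeometry.SAW.DomainSAW (Omega TE) 1 (toSite (0, -1)) (toSite (-1, 0)) :=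
  ⟨SimpleGraph.Walk.cons (goodT.A (0, -1) (0, 0)) <|
  SimpleGraph.Walk.cons (goodT.A (0, 0) (-1, 0)) <|
  SimpleGraph.Walk.nil, (SimpleGraph.Walk.isPath_def _).2 (by decide)⟩

/-- explicit self-avoiding walk `(0,-1) → (0,0) → (0,1) → (0,2) → (-1,2) → (-2,2) → (-2,1) → (-2,0) → (-1,0)` [folklore] -/
private def w_T_0_m1_3_1 : Literature.Probability.RandomPlanarGeometry.SAW.DomainSAW (Omega TE) 1 (toSite (0, -1)) (toSite (-1, 0)) :=
  ⟨SimpleGraph.Walk.cons (goodT.A (0, -1) (0, 0)) <|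
  SimpleGraph.Walk.cons (goodT.A (0, 0) (0, 1)) <|
  SimpleGraph.Walk.cons (goodT.A (0, 1) (0, 2)) <|
  SimpleGraph.Walk.cons (goodT.A (0, 2) (-1, 2)) <|
  SimpleGraph.Walk.cons (goodT.A (-1, 2) (-2, 2)) <|
  SimpleGraph.Walk.cons (goodT.A (-2, 2) (-2, 1)) <|
  SimpleGraph.Walk.cons (goodT.A (-2, 1) (-2, 0)) <|
  SimpleGraph.Walk.cons (goodT.A (-2, 0) (-1, 0)) <|
  SimpleGraph.Walk.nil, (SimpleGraph.Walk.isPath_def _).2 (by decide)⟩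

/-- Enumeration certificate: the self-avoiding walks of `Ω_E` between these endpoints are exactly the listed ones (completeness of `dfs` + `decide`). [folklore] -/
private theorem enum_T_0_m1_3 : ∀ γ : Literature.Probability.RandomPlanarGeometry.SAW.DomainSAW (Omega TE) 1 (toSite (0, -1)) (toSite (-1, 0)),
    γ = w_T_0_m1_3_0 ∨ γ = w_T_0_m1_3_1 := by
  intro γ
  have hmem := goodT.support_mem_dfs γ (by decide) (fuel := 20) (by decide)
  have hhead := head?_reverse_map_support γ.walk
  have hall : ∀ l ∈ dfs TE 20 [ofSite (toSite (0, -1))], l.head? = some (ofSite (toSite (-1, 0))) →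
      l = [(-1, 0), (0, 0), (0, -1)] ∨ l = [(-1, 0), (-2, 0), (-2, 1), (-2, 2), (-1, 2), (0, 2), (0, 1), (0, 0), (0, -1)] := by decide
  rcases hall _ hmem hhead with h | h
  · left; apply DomainSAW_eq_of_support; rw [support_eq_of_reverse_map γ.walk h]; decide
  · right; apply DomainSAW_eq_of_support; rw [support_eq_of_reverse_map γ.walk h]; decide

/-- the trivial walk at the root [folklore] -/
private def nil_T_0_m1 : Literature.Probability.RandomPlanarGeometry.SAW.DomainSAW (Omega TE) 1 (toSite (0, -1)) (toSite (0, -1)) := Literature.Probability.RandomPlanarGeometry.SAW.DomainSAW.nil _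

/-- Enumeration certificate: the self-avoiding walks of `Ω_E` between these endpoints are exactly the listed ones. [folklore] -/
private theorem enum_T_0_m1_4 : ∀ γ : Literature.Probability.RandomPlanarGeometry.SAW.DomainSAW (Omega TE) 1 (toSite (0, -1)) (toSite (0, -1)), γ = nil_T_0_m1 :=
  Literature.Probability.RandomPlanarGeometry.SAW.DomainSAW.eq_nil_of_self

/-- Value of one half-edge term of the stiffness observable on the explicit domain (enumeration certificate + integer turn/winding counts). [folklore] -/
private theorem sHET_T_0_m1_E_out (u v : ℂ) (σ : ℝ) :
    stiffnessHalfEdgeTerm (Omega TE) 1 (toSite (0, -1)) u v σ (toSite (0, 0)) (toSite (1, 0)) =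
      u * (tOf σ)⁻¹ := by
  rw [sHET_eq_single u v σ (toSite (1, 0)) w_T_0_m1_0_0 (fun γ hγ => absurd (enum_T_0_m1_0 γ) hγ)]
  rw [if_neg (by decide), winding_support_medial w_T_0_m1_0_0.walk (toSite (1, 0)) (by decide),
    show quarterTurns (List.map ofSite w_T_0_m1_0_0.walk.support ++ [ofSite (toSite (1, 0))]) = -1 from by decide,
    show turnCount (w_T_0_m1_0_0.walk.support ++ [toSite (1, 0)]) = 1 from by decide,
    show straightCount (w_T_0_m1_0_0.walk.support ++ [toSite (1, 0)]) = 0 from by decide, cexp_quarter_m1 σ]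
  ring

/-- Value of one half-edge term of the stiffness observable on the explicit domain (enumeration certificate + integer turn/winding counts). [folklore] -/
private theorem sHET_T_0_m1_E_in (u v : ℂ) (σ : ℝ) :
    stiffnessHalfEdgeTerm (Omega TE) 1 (toSite (0, -1)) u v σ (toSite (1, 0)) (toSite (0, 0)) =
      0 := by
  refine sHET_eq_zero u v σ (toSite (0, 0)) fun γ => ?_
  rw [enum_T_0_m1_1 γ]; decide

/-- Value of the stiffness mid-edge observable at one of the four edges at the origin, on the explicit domain. [folklore] -/
private theorem sF_T_0_m1_E (u v : ℂ) (σ : ℝ) :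
    stiffnessMidEdgeObservable (Omega TE) 1 (toSite (0, -1)) u v σ s(toSite (0, 0), toSite (1, 0)) =
      u * (tOf σ)⁻¹ := by
  simp only [stiffnessMidEdgeObservable_mk, sHET_T_0_m1_E_out, sHET_T_0_m1_E_in, add_zero]

/-- Value of one half-edge term of the stiffness observable on the explicit domain (enumeration certificate + integer turn/winding counts). [folklore] -/
private theorem sHET_T_0_m1_N_out (u v : ℂ) (σ : ℝ) :
    stiffnessHalfEdgeTerm (Omega TE) 1 (toSite (0, -1)) u v σ (toSite (0, 0)) (toSite (0, 1)) =
      v := by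
  rw [sHET_eq_single u v σ (toSite (0, 1)) w_T_0_m1_0_0 (fun γ hγ => absurd (enum_T_0_m1_0 γ) hγ)]
  rw [if_neg (by decide), winding_support_medial w_T_0_m1_0_0.walk (toSite (0, 1)) (by decide),
    show quarterTurns (List.map ofSite w_T_0_m1_0_0.walk.support ++ [ofSite (toSite (0, 1))]) = 0 from by decide,
    show turnCount (w_T_0_m1_0_0.walk.support ++ [toSite (0, 1)]) = 0 from by decide,
    show straightCount (w_T_0_m1_0_0.walk.support ++ [toSite (0, 1)]) = 1 from by decide, cexp_quarter_0 σ]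
  ring

/-- Value of one half-edge term of the stiffness observable on the explicit domain (enumeration certificate + integer turn/winding counts). [folklore] -/
private theorem sHET_T_0_m1_N_in (u v : ℂ) (σ : ℝ) :
    stiffnessHalfEdgeTerm (Omega TE) 1 (toSite (0, -1)) u v σ (toSite (0, 1)) (toSite (0, 0)) =
      u ^ 4 * v ^ 4 * (tOf σ)⁻¹ ^ 2 := by
  rw [sHET_eq_single u v σ (toSite (0, 0)) w_T_0_m1_2_1 (fun γ hγ => by
    rcases enum_T_0_m1_2 γ with rfl | rfl
    · decide
    · exact absurd rfl hγ
    )]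
  rw [if_neg (by decide), winding_support_medial w_T_0_m1_2_1.walk (toSite (0, 0)) (by decide),
    show quarterTurns (List.map ofSite w_T_0_m1_2_1.walk.support ++ [ofSite (toSite (0, 0))]) = -2 from by decide,
    show turnCount (w_T_0_m1_2_1.walk.support ++ [toSite (0, 0)]) = 4 from by decide,
    show straightCount (w_T_0_m1_2_1.walk.support ++ [toSite (0, 0)]) = 4 from by decide, cexp_quarter_m2 σ]
  ring

/-- Value of the stiffness mid-edge observable at one of the four edges at the origin, on the explicit domain. [folklore] -/
private theorem sF_T_0_m1_N (u v : ℂ) (σ : ℝ) :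
    stiffnessMidEdgeObservable (Omega TE) 1 (toSite (0, -1)) u v σ s(toSite (0, 0), toSite (0, 1)) =
      v + u ^ 4 * v ^ 4 * (tOf σ)⁻¹ ^ 2 := by
  simp only [stiffnessMidEdgeObservable_mk, sHET_T_0_m1_N_out, sHET_T_0_m1_N_in]

/-- Value of one half-edge term of the stiffness observable on the explicit domain (enumeration certificate + integer turn/winding counts). [folklore] -/
private theorem sHET_T_0_m1_W_out (u v : ℂ) (σ : ℝ) :
    stiffnessHalfEdgeTerm (Omega TE) 1 (toSite (0, -1)) u v σ (toSite (0, 0)) (toSite (-1, 0)) =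
      u * tOf σ := by
  rw [sHET_eq_single u v σ (toSite (-1, 0)) w_T_0_m1_0_0 (fun γ hγ => absurd (enum_T_0_m1_0 γ) hγ)]
  rw [if_neg (by decide), winding_support_medial w_T_0_m1_0_0.walk (toSite (-1, 0)) (by decide),
    show quarterTurns (List.map ofSite w_T_0_m1_0_0.walk.support ++ [ofSite (toSite (-1, 0))]) = 1 from by decide,
    show turnCount (w_T_0_m1_0_0.walk.support ++ [toSite (-1, 0)]) = 1 from by decide,
    show straightCount (w_T_0_m1_0_0.walk.support ++ [toSite (-1, 0)]) = 0 from by decide, cexp_quarter_1 σ]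
  ring

/-- Value of one half-edge term of the stiffness observable on the explicit domain (enumeration certificate + integer turn/winding counts). [folklore] -/
private theorem sHET_T_0_m1_W_in (u v : ℂ) (σ : ℝ) :
    stiffnessHalfEdgeTerm (Omega TE) 1 (toSite (0, -1)) u v σ (toSite (-1, 0)) (toSite (0, 0)) =
      u ^ 3 * v ^ 5 * tOf σ ^ 3 := by
  rw [sHET_eq_single u v σ (toSite (0, 0)) w_T_0_m1_3_1 (fun γ hγ => by
    rcases enum_T_0_m1_3 γ with rfl | rfl
    · decide
    · exact absurd rfl hγ
    )]
  rw [if_neg (by decide), winding_support_medial w_T_0_m1_3_1.walk (toSite (0, 0)) (by decide),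
    show quarterTurns (List.map ofSite w_T_0_m1_3_1.walk.support ++ [ofSite (toSite (0, 0))]) = 3 from by decide,
    show turnCount (w_T_0_m1_3_1.walk.support ++ [toSite (0, 0)]) = 3 from by decide,
    show straightCount (w_T_0_m1_3_1.walk.support ++ [toSite (0, 0)]) = 5 from by decide, cexp_quarter_3 σ]
  ring

/-- Value of the stiffness mid-edge observable at one of the four edges at the origin, on the explicit domain. [folklore] -/
private theorem sF_T_0_m1_W (u v : ℂ) (σ : ℝ) :
    stiffnessMidEdgeObservable (Omega TE) 1 (toSite (0, -1)) u v σ s(toSite (0, 0), toSite (-1, 0)) =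
      u * tOf σ + u ^ 3 * v ^ 5 * tOf σ ^ 3 := by
  simp only [stiffnessMidEdgeObservable_mk, sHET_T_0_m1_W_out, sHET_T_0_m1_W_in]

/-- Value of one half-edge term of the stiffness observable on the explicit domain (enumeration certificate + integer turn/winding counts). [folklore] -/
private theorem sHET_T_0_m1_S_out (u v : ℂ) (σ : ℝ) :
    stiffnessHalfEdgeTerm (Omega TE) 1 (toSite (0, -1)) u v σ (toSite (0, 0)) (toSite (0, -1)) =
      0 := by
  refine sHET_eq_zero u v σ (toSite (0, -1)) fun γ => ?_
  rw [enum_T_0_m1_0 γ]; decide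

/-- Value of one half-edge term of the stiffness observable on the explicit domain (enumeration certificate + integer turn/winding counts). [folklore] -/
private theorem sHET_T_0_m1_S_in (u v : ℂ) (σ : ℝ) :
    stiffnessHalfEdgeTerm (Omega TE) 1 (toSite (0, -1)) u v σ (toSite (0, -1)) (toSite (0, 0)) =
      1 := by
  rw [sHET_eq_single u v σ (toSite (0, 0)) nil_T_0_m1 (fun γ hγ => absurd (enum_T_0_m1_4 γ) hγ)]
  rw [if_neg (by decide), winding_support_medial nil_T_0_m1.walk (toSite (0, 0)) (by decide),
    show quarterTurns (List.map ofSite nil_T_0_m1.walk.support ++ [ofSite (toSite (0, 0))]) = 0 from by decide,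
    show turnCount (nil_T_0_m1.walk.support ++ [toSite (0, 0)]) = 0 from by decide,
    show straightCount (nil_T_0_m1.walk.support ++ [toSite (0, 0)]) = 0 from by decide, cexp_quarter_0 σ]
  ring

/-- Value of the stiffness mid-edge observable at one of the four edges at the origin, on the explicit domain. [folklore] -/
private theorem sF_T_0_m1_S (u v : ℂ) (σ : ℝ) :
    stiffnessMidEdgeObservable (Omega TE) 1 (toSite (0, -1)) u v σ s(toSite (0, 0), toSite (0, -1)) =
      1 := by
  simp only [stiffnessMidEdgeObservable_mk, sHET_T_0_m1_S_out, sHET_T_0_m1_S_in, zero_add]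

/-- The stiffness vertex relation instantiated on domain `T` with root `(0, -1)`. [folklore] -/
private theorem sinst_T_0_m1 {u v : ℂ} {σ : ℝ} {c : Fin 4 → ℂ} (hrel : ExactVertexRelationZ2Stiffness u v σ c) :
    c 0 * (u * (tOf σ)⁻¹) + c 1 * (v + u ^ 4 * v ^ 4 * (tOf σ)⁻¹ ^ 2) + c 2 * (u * tOf σ + u ^ 3 * v ^ 5 * tOf σ ^ 3) + c 3 * (1) = 0 := by
  have h := hrel (Omega TE) 1 (toSite (0, -1)) (toSite (0, 0)) one_pos
    ((goodT.mem_meshDomain_iff _).2 (by decide))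
    ⟨toSite (0, -2), zdAdj_toSite_down (0, -1), by
      rw [meshPoint_one_toSite, pt_mem_Omega_iff goodT.unit]; decide⟩
    (adj_four goodT (by decide) (by decide) (by decide) (by decide))
  rw [sum_four_dirZ2] at h
  rw [sF_T_0_m1_E, sF_T_0_m1_N, sF_T_0_m1_W, sF_T_0_m1_S] at h
  linear_combination h

/-! ### Elimination -/

/-- **The elimination.** The six rows (`P` with its four roots — group one; `T` rooted east and
south — group one plus the adjacent-return pair seen from two sides) force `c = 0` whenever
`u v ≠ 0` and `u² ≠ v²`; here `s` stands for `t⁻¹` (only `s t = 1` is used). [folklore] -/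
private theorem stiffness_elim {u v t s c₀ c₁ c₂ c₃ : ℂ} (hu : u ≠ 0) (hv : v ≠ 0) (huv : u ^ 2 ≠ v ^ 2)
    (hs : s * t = 1)
    (hPE : c₀ * 1 + c₁ * (u * s) + c₂ * v + c₃ * (u * t) = 0)
    (hPN : c₀ * (u * t) + c₁ * 1 + c₂ * (u * s) + c₃ * v = 0)
    (hPW : c₀ * v + c₁ * (u * t) + c₂ * 1 + c₃ * (u * s) = 0)
    (hPS : c₀ * (u * s) + c₁ * v + c₂ * (u * t) + c₃ * 1 = 0)
    (hTE : c₀ * 1 + c₁ * (u * s + u ^ 3 * v ^ 5 * s ^ 3) + c₂ * (v + u ^ 4 * v ^ 4 * t ^ 2) + c₃ * (u * t) = 0)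
    (hTS : c₀ * (u * s) + c₁ * (v + u ^ 4 * v ^ 4 * s ^ 2) + c₂ * (u * t + u ^ 3 * v ^ 5 * t ^ 3) + c₃ * 1 = 0) :
    c₀ = 0 ∧ c₁ = 0 ∧ c₂ = 0 ∧ c₃ = 0 := by
  have ht : t ≠ 0 := right_ne_zero_of_mul_eq_one hs
  have hs0 : s ≠ 0 := left_ne_zero_of_mul_eq_one hs
  have hvu : v ^ 2 - u ^ 2 ≠ 0 := sub_ne_zero.2 (Ne.symm huv)
  -- the two adjacent-return pair conditions (prefix from the east / from the south)
  have D1 : c₁ * (u ^ 3 * v ^ 5 * s ^ 3) + c₂ * (u ^ 4 * v ^ 4 * t ^ 2) = 0 := by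
    linear_combination hTE - hPE
  have D2 : c₁ * (u ^ 4 * v ^ 4 * s ^ 2) + c₂ * (u ^ 3 * v ^ 5 * t ^ 3) = 0 := by
    linear_combination hTS - hPS
  -- determinant `v² - u²`
  have h1 : c₁ * (u ^ 3 * v ^ 4 * s ^ 2 * (v ^ 2 - u ^ 2)) = 0 := by
    linear_combination (v * t) * D1 - u * D2 - (c₁ * u ^ 3 * v ^ 6 * s ^ 2) * hs
  have hc1 : c₁ = 0 := by
    rcases mul_eq_zero.1 h1 with h | h
    · exact h
    · exfalso
      exact (mul_ne_zero (mul_ne_zero (mul_ne_zero (pow_ne_zero 3 hu) (pow_ne_zero 4 hv))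
        (pow_ne_zero 2 hs0)) hvu) h
  have hc2 : c₂ = 0 := by
    have h2 : c₂ * (u ^ 4 * v ^ 4 * t ^ 2) = 0 := by linear_combination D1 - (u ^ 3 * v ^ 5 * s ^ 3) * hc1
    rcases mul_eq_zero.1 h2 with h | h
    · exact h
    · exfalso
      exact (mul_ne_zero (mul_ne_zero (pow_ne_zero 4 hu) (pow_ne_zero 4 hv)) (pow_ne_zero 2 ht)) h
  -- group one with `c₁ = c₂ = 0`
  have G2 : c₃ * (v - u ^ 2 * t ^ 2) = 0 := by
    linear_combination hPN - (u * t) * hPE - (1 - u ^ 2 * s * t) * hc1 - (u * s - u * t * v) * hc2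
  have G3 : c₃ * (u * s - u * v * t) = 0 := by
    linear_combination hPW - v * hPE - (u * t - u * v * s) * hc1 - (1 - v ^ 2) * hc2
  have hc3 : c₃ = 0 := by
    by_contra h3
    have e2 : v - u ^ 2 * t ^ 2 = 0 := (mul_eq_zero.1 G2).resolve_left h3
    have e3 : u * s - u * v * t = 0 := (mul_eq_zero.1 G3).resolve_left h3
    have e3' : s - v * t = 0 := by
      have h' : u * (s - v * t) = 0 := by linear_combination e3
      exact (mul_eq_zero.1 h').resolve_left hu
    exact huv (by linear_combination (-u ^ 2) * hs + (u ^ 2 * t) * e3' - v * e2)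
  have hc0 : c₀ = 0 := by
    linear_combination hPE - (u * s) * hc1 - v * hc2 - (u * t) * hc3
  exact ⟨hc0, hc1, hc2, hc3⟩

end NoVertexRelationStiffness

open NoVertexRelation NoVertexRelationStiffness in
/-- **The stiffness technique class is empty off the diagonal**: for `u v ≠ 0`, `u² ≠ v²`, every
real spin `σ`, `ExactVertexRelationZ2Stiffness u v σ c → c = 0`. Formal technique-class
counterpart (proved here from six explicit instances) of the printed classification's "no
discretely holomorphic weights with `w₁ = w₂ = 0`". [cite: Glazman2015WeightedSAW, Lemma 3.1] -/
theorem exactVertexRelationZ2Stiffness_eq_zero {u v : ℂ} {σ : ℝ} {c : Fin 4 → ℂ} (hu : u ≠ 0)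
    (hv : v ≠ 0) (huv : u ^ 2 ≠ v ^ 2) (hrel : ExactVertexRelationZ2Stiffness u v σ c) : c = 0 := by
  have ht : tOf σ ≠ 0 := by
    intro h
    have h1 := norm_tOf σ
    rw [h, norm_zero] at h1
    exact zero_ne_one h1
  have hs : (tOf σ)⁻¹ * tOf σ = 1 := inv_mul_cancel₀ ht
  obtain ⟨h0, h1, h2, h3⟩ := stiffness_elim hu hv huv hs (sinst_P_1_0 hrel) (sinst_P_0_1 hrel)
    (sinst_P_m1_0 hrel) (sinst_P_0_m1 hrel) (sinst_T_1_0 hrel) (sinst_T_0_m1 hrel)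
  funext i
  fin_cases i
  · exact h0
  · exact h1
  · exact h2
  · exact h3

/-- Discharge of the barrier statement `NoExactVertexRelationZ2Stiffness`.
[cite: Glazman2015WeightedSAW, Lemma 3.1] -/
theorem NoExactVertexRelationZ2Stiffness_holds : NoExactVertexRelationZ2Stiffness :=
  fun _ _ _ _ hu hv huv hrel => exactVertexRelationZ2Stiffness_eq_zero hu hv huv hrel

/-- **Physical slice.** For real positive fugacities `u ≠ v` (a genuine stiffness: turning and
straight vertices weighted differently) no exact vertex relation exists, at any spin; printed
counterpart: [cite: Glazman2015WeightedSAW, Lemma 3.1] -/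
theorem exactVertexRelationZ2Stiffness_eq_zero_real {u v σ : ℝ} {c : Fin 4 → ℂ} (hu : 0 < u)
    (hv : 0 < v) (huv : u ≠ v) (hrel : ExactVertexRelationZ2Stiffness u v σ c) : c = 0 := by
  refine exactVertexRelationZ2Stiffness_eq_zero (Complex.ofReal_ne_zero.2 hu.ne')
    (Complex.ofReal_ne_zero.2 hv.ne') ?_ hrel
  intro h
  apply huv
  have h' : (u : ℂ) ^ 2 = (v : ℂ) ^ 2 := h
  have h'' : u ^ 2 = v ^ 2 := by exact_mod_cast h'
  nlinarith [sq_nonneg (u - v), sq_nonneg (u + v)]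

/-- **The diagonal, from Appendix A.** For the uniform walk (`u = v = x ∈ (0,1)`) the stiffness
class is Appendix A's class and is empty by `exactVertexRelationZ2_eq_zero`.
[cite: DuminilCopin2013Parafermion, Remark 12.13] [cite: Glazman2015WeightedSAW, Lemma 3.1] -/
theorem exactVertexRelationZ2Stiffness_eq_zero_diag {x σ : ℝ} {c : Fin 4 → ℂ} (hx0 : 0 < x)
    (hx1 : x < 1) (hrel : ExactVertexRelationZ2Stiffness x x σ c) : c = 0 :=
  exactVertexRelationZ2_eq_zero hx0 hx1 ((exactVertexRelationZ2Stiffness_diag_iff hx0.ne' σ c).1 hrel)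

end TechniqueClassEmpty

end Literature.Barriers.CriticalPhenomena
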